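import Literature.MathematicalPhysics.QuantumFieldTheory.Federbush1986.ModeAnalyticity
import Literature.MathematicalPhysics.QuantumFieldTheory.Federbush1986.AbelianModeEstimates
import Literature.Analysis.Complex.HorizontalStripResidues

/-!
# `Federbush1986.ModeDecayPaleyWiener` — [FederbushWilliamson1987PhaseCellII] §IV p. 1417 «Equations (3.13)–(3.15) of Ref. 1
# follow directly from Theorems 3.2 and 3.3 of the last section by standard techniques» PROVED: the Paley–Wiener contour
# shift on `ℝ⁴` from the analyticity domain (3.3) and the bound (3.5) to the position-space decay I (3.13)–(3.15) (theorems only)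

statement-level skeleton of published theorems with citation tags; proofs where landed; nothing here is a claim about the Yang–Mills mass gap

CITATION HEADER.  P. Federbush, C. Williamson, *A phase cell approach to Yang–Mills theory. II. Analysis of a mode*, J. Math.
Phys. **28** (1987) 1416–1419 [FederbushWilliamson1987PhaseCellII] (cell paper F2; p. 1417 READ AS IMAGE `run/shared/lean/pub/
pub-balaban/t4/b2b-balaban-t4-lit2/g7/fw1987II/fedwill1987-jmp28-II-p002-x2.png`); P. Federbush, *… I. Modes, lattice-continuum
duality*, Commun. Math. Phys. **107** (1986) 319–329 [Federbush1986PhaseCellI] (F1), p. 328 READ AS IMAGE (`HOME/lit-balaban-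
r17/renders/fedI/fed1986-cmp107-p010-x2.png`).  Printed precedent of the method: K. Gawędzki, A. Kupiainen, Commun. Math. Phys.
**77** (1980), Appendix («The analysis we follow herein is analogous to the similar analysis due to Gawedzki and Kupiainen in the
appendix of Ref. 2», II p. 1417).  Unit `lit-balaban-r17` gen 6 (reader/typer r17 = F-fold owner); SKELETON row **F2.Sect§IV** of
`HOME/lit-balaban-r17/SKELETON-r17.md` (Phase 1: `absent (asserted implication; Paley–Wiener type)`), cells of **F1.Eq3.13-3.15**,
**F2.Thm3.2**, **F2.Thm3.3**.  Inputs BY NAME: `ModeAnalyticity.Momentum/csq/DG/DB/realGeneric/AN/Theorem32/Theorem33/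
Theorems31to33` (`ModeAnalyticity`, unit r17), `AbelianAveraging.Decay313to315`, `E4`, `unitVec`, `pd` (`AbelianModeEstimates`,
unit r17), the tree's pole-free horizontal contour shift `Literature.Analysis.Complex.integral_horizontal_eq_of_differentiableOn`
(`Analysis/Complex/HorizontalStripResidues`), and Mathlib (`volume_preserving_piFinSuccAbove`, `integral_prod_symm`,
`Integrable.fintype_prod`, `integrable_rpow_neg_one_add_norm_sq`, `hasFDerivAt_integral_of_dominated_of_fderiv_le`,
`continuous_of_dominated`, `HasFDerivAt.cexp`, `Complex.norm_exp_sub_one_le`).  HOME `run/shared/lean/pub/lit-balaban/`.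

WHAT IS PRINTED (verbatim).  II p. 1417: «Theorem 3.2 (Global analyticity): A^N_i(p) is analytic in the domain, 𝒟_G, specified
by |Im p_j| < ε₀. (3.3)  Theorem 3.3 (Boundedness): Within the domain, 𝒟_B, specified by |Im p_j| < ε₀/2, (3.4) A^N_i(p) satisfies
bounds of the form |A^N_i(p)| < c Π_j (1/(|p_j| + 1)) (1/(|p²| + 1)). (3.5) … IV. CONCLUSIONS  Equations (3.13)–(3.15) of Ref. 1
follow directly from Theorems 3.2 and 3.3 of the last section by standard techniques.»  I p. 328: «A^N_μ(x) is the Fourier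
transform of A(p), where A_i(p) = A′_i(p) + p_iX(p) for a suitable X(p) to be specified in Part II. We there show:
|A^N_μ(x)| < ce^{−γ|x|}, (3.13) |DA^N_μ(x)| < ce^{−γ|x|}, (3.14) (1/|x − y|^{1−ε}) |DA^N_μ(x) − DA^N_μ(y)| < c_εe^{−γ|x|}, (3.15) for
each ε > 0, |x − y| < 1.»

WHAT THIS MODULE PROVES — the «standard techniques» (Paley–Wiener contour shift on `ℝ⁴`), for ANY momentum-space mode `Â` of
the asserted shape: analytic on `𝒟_G = {|Im p_j| < ε₀}` (conclusion of Thm 3.2, shape of `Theorem32`) and bounded by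
`cΠ_j(|p_j| + 1)⁻¹(|p²| + 1)⁻¹` on `𝒟_B` (conclusion of Thm 3.3, shape of `Theorem33`).  With `A(x) := ∫_{ℝ⁴} e^{ip·x}Â(p) d⁴p`
(`modeFT`; normalisation and sign convention immaterial and omitted):
 * §1 the (3.5) majorant on the tube `|Im p_j| ≤ κ`: `(1 + |Σ z_j²|)⁻¹ ≤ (1 + 4κ²)(1 + Σ(Re z_j)²)⁻¹` (`inv_one_add_norm_csq_le`),
   whence `|Â(p + iτ)|, |(p + iτ)_νÂ(p + iτ)| ≤ c(1 + 4κ²)ψ_ν(p)`, `ψ_ν(p) = Π_{j≠ν}(1 + |p_j|)⁻¹(1 + Σp_j²)⁻¹` (`norm_le_psi_of_bound`),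
   and `(1 + Σp_j²)^{θ/2}ψ_ν ∈ L¹(ℝ⁴)` for `θ < 1` (`integrable_rpow_mul_psi`: exponent bookkeeping `rpow_sum_le_prod` + products of
   one-dimensional integrable factors, `Integrable.fintype_prod`);
 * §2 the CONTOUR SHIFT on `ℝ⁴`: Fubini with one coordinate singled out (`integral_eq_iterated`), the pole-free horizontal shift
   in that coordinate for every real value of the others (vertical cross-sections vanish by `ψ_ν ≤ (1 + p_i²)⁻¹`), hence
   `∫H(p + iτ)d⁴p` is unchanged when one component of `τ` moves in `[−κ, κ]` (`shift_one_coord`) and `∫H(p)d⁴p = ∫H(p + iσ)d⁴p` for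
   every `σ` in the `κ`-box (`shift_all`), for `H` holomorphic on the `ρ`-tube (`κ < ρ`) with a majorant `Bψ_ν`;
 * §3 (3.13): with `σ_j = ±ε₀/4` by the sign of `x_j`, `|e^{i(p+iσ)·x}| = e^{−(ε₀/4)Σ|x_j|} ≤ e^{−(ε₀/4)|x|}`, so
   `|A(x)| ≤ c(1 + ε₀²/4)(∫ψ_ν)e^{−(ε₀/4)|x|}` (`norm_modeFT_le`);
 * §4 differentiation under the integral (`hasFDerivAt_modeFT`, dominating function `cΣ_jψ_j`), `A ∈ C¹` (`contDiff_modeFT`),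
   `∂_νA(x) = ∫Â(p)e^{ip·x}(ip_ν)d⁴p` (`fderiv_modeFT_unitVec`) and (3.14) `|∂_νA(x)| ≤ c(1 + ε₀²/4)(∫ψ_ν)e^{−(ε₀/4)|x|}`
   (`norm_fderiv_modeFT_le`, via the abstract shifted bound `norm_integral_le_of_phase_majorant`);
 * §5 (3.15): both `∂_νA(x)` and `∂_νA(y)` on the SAME contour `p + iσ(x)`; `|e^{iz·y} − e^{iz·x}| = |e^{iz·x}||e^{iz·(y−x)} − 1|`,
   `|e^w − 1| ≤ 2e^{|Re w|}|w|^θ` (`norm_exp_sub_one_le_rpow`), `|w| ≤ (Σ|p_j| + ε₀)|x − y|`, `(Σ|p_j| + ε₀)^θ ≤ 5(1 + ε₀)(1 + Σp_j²)^{θ/2}`: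
   `|∂_νA(x) − ∂_νA(y)| ≤ 10e^{ε₀}(1 + ε₀)c(1 + ε₀²/4)(∫(1 + Σp²)^{θ/2}ψ_ν)|x − y|^θ e^{−(ε₀/4)|x|}` for `0 ≤ θ < 1`, `|x − y| < 1`
   (`norm_fderiv_modeFT_sub_le`; `θ = 1 − min(ε,1)` serves print's `ε`);
 * §6 **`decay313to315_modeField`**: the real field `x ↦ (Re ∫e^{ip·x}Â_μ(p)d⁴p)_μ` INHABITS `AbelianAveraging.Decay313to315`
   (`C¹`, (3.13), (3.14), (3.15) with `γ = ε₀/4`) — row F2.Sect§IV PROVED as the printed implication, row F1.Eq3.13-3.15's typed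
   package inhabited from F2-type hypotheses;
 * §7 `decay313to315_of_theorem33_shape` (component-wise `ε₀`, extensions and constants as `Theorem33` delivers them) and
   `decay313to315_of_theorems31to33 : Theorems31to33 → ∀ large s, ∃ g (= A^N on the real generic momenta), Decay313to315 (modeField g)`
   — §IV as the typed implication.  HONEST SCOPE: `Theorems31to33` is REFUTED AS TYPED for the printed `A^N_1` in the printed gauge
   (`ModeAnalyticityThm31Refutation.not_theorems31to33`, p250244, GAPS §G-F2-01: pole on the light cone at `p = 0`); the content
   of this file is the implication §IV itself, valid for every mode of the asserted shape (e.g. the gauge-repaired mode of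
   `ModeAnalyticityGaugeRepair`, p251790, once its Theorem 3.2/3.3-shape bounds are supplied).  Normalisation `(2π)^{-4}`,
   the sign of the exponent, and realness of `A^N` (here: real part) are immaterial to (3.13)–(3.15) and not tracked.

Theorems only (plus the definitions with bodies `toC`, `shiftI`, `phase`, `modeFT`, `psi`, `sliceC`, `sgnShift`, `dirCLM`,
`dIntegrand`, `dKernel`, `modeField` — objects, no `Prop` definitions, no named facts); axioms standard.
-/

namespace Literature.MathematicalPhysics.QuantumFieldTheory.Federbush1986

noncomputable section

open Complex MeasureTheory Filter Set Real
open scoped BigOperators Topology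

namespace ModeDecay

open ModeAnalyticity

/-! ## §0 Objects: real momenta, tube shifts, the phase and the position-space field -/

/-- A real momentum `p ∈ ℝ⁴` as a point of `ℂ⁴`. [cite: FederbushWilliamson1987PhaseCellII, §III p. 1417] -/
def toC (p : Fin 4 → ℝ) : Momentum := fun j => (p j : ℂ)

/-- The shifted momentum `p + iτ` («We take the analytic extensions … from real p to complex p», §III p. 1417).
[cite: FederbushWilliamson1987PhaseCellII, §III (3.3)–(3.4) p. 1417] -/
def shiftI (p τ : Fin 4 → ℝ) : Momentum := fun j => (p j : ℂ) + (τ j : ℂ) * I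

/-- The Fourier character `e^{i z·x}` at the position `x ∈ ℝ⁴`, for complex momenta `z`.
[cite: Federbush1986PhaseCellI, (3.6)–(3.7), (3.12) p. 327–328] -/
def phase (x : E4) (z : Momentum) : ℂ := Complex.exp (I * ∑ j, z j * ((x j : ℝ) : ℂ))

/-- The position-space field of a momentum-space mode: `A(x) = ∫_{ℝ⁴} e^{ip·x} Â(p) d⁴p` («A^N_μ(x) is the Fourier transform of
A(p)», I p. 328; normalisation constants and the sign convention are immaterial for (3.13)–(3.15) and are omitted).
[cite: Federbush1986PhaseCellI, (3.12)–(3.13) p. 328; FederbushWilliamson1987PhaseCellII, §IV p. 1417] -/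
def modeFT (Ahat : Momentum → ℂ) (x : E4) : ℂ := ∫ p : Fin 4 → ℝ, phase x (toC p) * Ahat (toC p)

/-- `p + i0 = p`. [cite: FederbushWilliamson1987PhaseCellII, §III p. 1417] -/
@[simp] theorem shiftI_zero (p : Fin 4 → ℝ) : shiftI p 0 = toC p := by
  funext j; simp [shiftI, toC]

/-- Real and imaginary parts of `p + iτ`. [cite: FederbushWilliamson1987PhaseCellII, §III p. 1417] -/
@[simp] theorem shiftI_re (p τ : Fin 4 → ℝ) (j : Fin 4) : (shiftI p τ j).re = p j := by
  simp [shiftI]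

/-- Imaginary part of `p + iτ`. [cite: FederbushWilliamson1987PhaseCellII, §III p. 1417] -/
@[simp] theorem shiftI_im (p τ : Fin 4 → ℝ) (j : Fin 4) : (shiftI p τ j).im = τ j := by
  simp [shiftI]

/-- `p + iτ ∈ 𝒟_B` when `|τ_j| < ε₀/2`. [cite: FederbushWilliamson1987PhaseCellII, (3.4) p. 1417] -/
theorem shiftI_mem_DB {ε₀ : ℝ} {τ : Fin 4 → ℝ} (hτ : ∀ j, |τ j| < ε₀ / 2) (p : Fin 4 → ℝ) : shiftI p τ ∈ DB ε₀ :=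
  fun j => by rw [shiftI_im]; exact hτ j

/-- `p + iτ ∈ 𝒟_G` when `|τ_j| < ε₀`. [cite: FederbushWilliamson1987PhaseCellII, (3.3) p. 1417] -/
theorem shiftI_mem_DG {ε₀ : ℝ} {τ : Fin 4 → ℝ} (hτ : ∀ j, |τ j| < ε₀) (p : Fin 4 → ℝ) : shiftI p τ ∈ DG ε₀ :=
  fun j => by rw [shiftI_im]; exact hτ j

/-! ## §1 The majorant (3.5) on the tube `|Im p_j| ≤ κ` and its integrability over `ℝ⁴` -/

/-- On the tube `|Im z_j| ≤ κ`: `(1 + |Σ_j z_j²|)⁻¹ ≤ (1 + 4κ²)(1 + Σ_j (Re z_j)²)⁻¹` — the factor `1/(|p²| + 1)` of (3.5)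
controls the real momenta uniformly on the tube. [cite: FederbushWilliamson1987PhaseCellII, (3.5) p. 1417] -/
theorem inv_one_add_norm_csq_le {κ : ℝ} {z : Momentum} (hz : ∀ j, |(z j).im| ≤ κ) :
    (1 + ‖csq z‖)⁻¹ ≤ (1 + 4 * κ ^ 2) * (1 + ∑ j, (z j).re ^ 2)⁻¹ := by
  have hu0 : 0 ≤ ∑ j, (z j).re ^ 2 := Finset.sum_nonneg fun j _ => sq_nonneg _
  set u := ∑ j, (z j).re ^ 2 with hu
  set s := ∑ j, (z j).im ^ 2 with hs
  have hs0 : 0 ≤ s := Finset.sum_nonneg fun j _ => sq_nonneg _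
  have hsκ : s ≤ 4 * κ ^ 2 := by
    have h1 : ∀ j, (z j).im ^ 2 ≤ κ ^ 2 := fun j => by
      have := hz j
      have hκ : 0 ≤ κ := (abs_nonneg _).trans this
      nlinarith [abs_nonneg ((z j).im), sq_abs ((z j).im)]
    calc s = ∑ j, (z j).im ^ 2 := hs
      _ ≤ ∑ _j : Fin 4, κ ^ 2 := Finset.sum_le_sum fun j _ => h1 j
      _ = 4 * κ ^ 2 := by simp
  -- Re (Σ z_j²) = u - s
  have hre : (csq z).re = u - s := by
    simp only [csq, Complex.re_sum, hu, hs, ← Finset.sum_sub_distrib]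
    refine Finset.sum_congr rfl fun j _ => ?_
    rw [sq, Complex.mul_re]; ring
  have hnorm : u - s ≤ ‖csq z‖ := by
    have := Complex.re_le_norm (csq z)
    rw [hre] at this; exact this
  have hpos : 0 < 1 + ‖csq z‖ := by positivity
  rw [inv_le_comm₀ hpos (by positivity), mul_inv, inv_inv, ← div_eq_inv_mul, div_le_iff₀ (by positivity)]
  -- (1 + u) ≤ (1 + ‖csq‖)(1 + 4κ²)
  by_cases hus : s ≤ u
  · nlinarith [hnorm, hsκ, hs0, norm_nonneg (csq z), mul_nonneg hs0 (sub_nonneg.2 hus)]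
  · rw [not_le] at hus
    nlinarith [norm_nonneg (csq z), hsκ, hus]

/-- `1/(|z_j| + 1) ≤ 1/(|Re z_j| + 1)`. [cite: FederbushWilliamson1987PhaseCellII, (3.5) p. 1417] -/
theorem inv_norm_add_one_le (w : ℂ) : (‖w‖ + 1)⁻¹ ≤ (|w.re| + 1)⁻¹ := by
  have h := Complex.abs_re_le_norm w
  exact inv_anti₀ (by positivity) (by linarith)

/-- The real-momentum majorant `ψ_ν(p) = Π_{j ≠ ν} (1 + |p_j|)⁻¹ · (1 + Σ_j p_j²)⁻¹` (the (3.5) bound with the factor in the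
direction `ν` spent — on `|p_ν Â(p)|` for (3.14), or simply dropped for (3.13)). [cite: FederbushWilliamson1987PhaseCellII, (3.5) p. 1417] -/
def psi (ν : Fin 4) (p : Fin 4 → ℝ) : ℝ := (∏ j ∈ Finset.univ.erase ν, (1 + |p j|)⁻¹) * (1 + ∑ j, p j ^ 2)⁻¹

/-- `ψ_ν ≥ 0`. [cite: FederbushWilliamson1987PhaseCellII, (3.5) p. 1417] -/
theorem psi_nonneg (ν : Fin 4) (p : Fin 4 → ℝ) : 0 ≤ psi ν p := by
  unfold psi
  refine mul_nonneg (Finset.prod_nonneg fun j _ => ?_) ?_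
  · positivity
  · have : 0 ≤ ∑ j, p j ^ 2 := Finset.sum_nonneg fun j _ => sq_nonneg _
    positivity

/-- `ψ_ν ≤ 1`. [cite: FederbushWilliamson1987PhaseCellII, (3.5) p. 1417] -/
theorem psi_le_one (ν : Fin 4) (p : Fin 4 → ℝ) : psi ν p ≤ 1 := by
  unfold psi
  have h0 : 0 ≤ ∑ j, p j ^ 2 := Finset.sum_nonneg fun j _ => sq_nonneg _
  have h1 : (∏ j ∈ Finset.univ.erase ν, (1 + |p j|)⁻¹) ≤ 1 := by
    refine Finset.prod_le_one (fun j _ => by positivity) fun j _ => ?_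
    exact inv_le_one_of_one_le₀ (by linarith [abs_nonneg (p j)])
  have h2 : (1 + ∑ j, p j ^ 2)⁻¹ ≤ 1 := inv_le_one_of_one_le₀ (by linarith)
  calc _ ≤ 1 * 1 := mul_le_mul h1 h2 (by positivity) zero_le_one
    _ = 1 := one_mul _

/-- **The (3.5) bound on the tube, real-momentum form.**  If `|Â(z)| ≤ c Π_j (|z_j| + 1)⁻¹ (|z²| + 1)⁻¹` on `𝒟_B` (Theorem 3.3's
shape), then for `|τ_j| ≤ κ`, `τ ∈ 𝒟_B`-admissible: `|Â(p + iτ)| ≤ c(1 + 4κ²) ψ_ν(p)` and `|(p + iτ)_ν Â(p + iτ)| ≤ c(1 + 4κ²) ψ_ν(p)`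
for every direction `ν`. [cite: FederbushWilliamson1987PhaseCellII, Theorem 3.3 (3.4)–(3.5) p. 1417] -/
theorem norm_le_psi_of_bound {Ahat : Momentum → ℂ} {ε₀ c κ : ℝ}
    (hB : ∀ z ∈ DB ε₀, ‖Ahat z‖ ≤ c * (∏ j, (‖z j‖ + 1)⁻¹) * (‖csq z‖ + 1)⁻¹)
    {τ : Fin 4 → ℝ} (hτ : ∀ j, |τ j| < ε₀ / 2) (hτκ : ∀ j, |τ j| ≤ κ) (hc : 0 ≤ c) (ν : Fin 4) (p : Fin 4 → ℝ) :
    ‖Ahat (shiftI p τ)‖ ≤ c * (1 + 4 * κ ^ 2) * psi ν p ∧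
      ‖shiftI p τ ν * Ahat (shiftI p τ)‖ ≤ c * (1 + 4 * κ ^ 2) * psi ν p := by
  have hz := hB _ (shiftI_mem_DB hτ p)
  have hcsq : (‖csq (shiftI p τ)‖ + 1)⁻¹ ≤ (1 + 4 * κ ^ 2) * (1 + ∑ j, p j ^ 2)⁻¹ := by
    have h := inv_one_add_norm_csq_le (z := shiftI p τ) (κ := κ) (fun j => by rw [shiftI_im]; exact hτκ j)
    simp only [shiftI_re] at h
    rwa [add_comm] at h
  have hfac : ∀ j, (‖shiftI p τ j‖ + 1)⁻¹ ≤ (1 + |p j|)⁻¹ := fun j => by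
    have h := inv_norm_add_one_le (shiftI p τ j)
    rw [shiftI_re, add_comm (|p j|)] at h
    exact h
  have hfac0 : ∀ j, 0 ≤ (‖shiftI p τ j‖ + 1)⁻¹ := fun j => by positivity
  have hfac1 : ∀ j, (‖shiftI p τ j‖ + 1)⁻¹ ≤ 1 := fun j =>
    inv_le_one_of_one_le₀ (by linarith [norm_nonneg (shiftI p τ j)])
  -- split off the factor ν
  have hsplit : (∏ j, (‖shiftI p τ j‖ + 1)⁻¹) =
      (‖shiftI p τ ν‖ + 1)⁻¹ * ∏ j ∈ Finset.univ.erase ν, (‖shiftI p τ j‖ + 1)⁻¹ :=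
    (Finset.mul_prod_erase Finset.univ (fun j => (‖shiftI p τ j‖ + 1)⁻¹) (Finset.mem_univ ν)).symm
  have hrest : (∏ j ∈ Finset.univ.erase ν, (‖shiftI p τ j‖ + 1)⁻¹) ≤ ∏ j ∈ Finset.univ.erase ν, (1 + |p j|)⁻¹ :=
    Finset.prod_le_prod (fun j _ => hfac0 j) fun j _ => hfac j
  have hrest0 : 0 ≤ ∏ j ∈ Finset.univ.erase ν, (‖shiftI p τ j‖ + 1)⁻¹ := Finset.prod_nonneg fun j _ => hfac0 j
  have hsum0 : 0 ≤ (1 + ∑ j, p j ^ 2)⁻¹ := by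
    have : 0 ≤ ∑ j, p j ^ 2 := Finset.sum_nonneg fun j _ => sq_nonneg _
    positivity
  have hcsq0 : 0 ≤ (‖csq (shiftI p τ)‖ + 1)⁻¹ := by positivity
  -- the common tail bound: (rest) * (csq factor) ≤ (1+4κ²) ψ
  have htail : (∏ j ∈ Finset.univ.erase ν, (‖shiftI p τ j‖ + 1)⁻¹) * (‖csq (shiftI p τ)‖ + 1)⁻¹ ≤
      (1 + 4 * κ ^ 2) * psi ν p := by
    unfold psi
    calc _ ≤ (∏ j ∈ Finset.univ.erase ν, (1 + |p j|)⁻¹) * ((1 + 4 * κ ^ 2) * (1 + ∑ j, p j ^ 2)⁻¹) :=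
          mul_le_mul hrest hcsq hcsq0 (Finset.prod_nonneg fun j _ => by positivity)
      _ = _ := by ring
  constructor
  · calc ‖Ahat (shiftI p τ)‖ ≤ c * (∏ j, (‖shiftI p τ j‖ + 1)⁻¹) * (‖csq (shiftI p τ)‖ + 1)⁻¹ := hz
      _ = c * ((‖shiftI p τ ν‖ + 1)⁻¹ *
            ((∏ j ∈ Finset.univ.erase ν, (‖shiftI p τ j‖ + 1)⁻¹) * (‖csq (shiftI p τ)‖ + 1)⁻¹)) := by
          rw [hsplit]; ring
      _ ≤ c * (1 * ((1 + 4 * κ ^ 2) * psi ν p)) := by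
          refine mul_le_mul_of_nonneg_left ?_ hc
          exact mul_le_mul (hfac1 ν) htail (mul_nonneg hrest0 hcsq0) zero_le_one
      _ = c * (1 + 4 * κ ^ 2) * psi ν p := by ring
  · rw [norm_mul]
    have hνfac : ‖shiftI p τ ν‖ * (‖shiftI p τ ν‖ + 1)⁻¹ ≤ 1 := by
      rw [← div_eq_mul_inv, div_le_one (by positivity)]; linarith
    calc ‖shiftI p τ ν‖ * ‖Ahat (shiftI p τ)‖
        ≤ ‖shiftI p τ ν‖ * (c * (∏ j, (‖shiftI p τ j‖ + 1)⁻¹) * (‖csq (shiftI p τ)‖ + 1)⁻¹) :=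
          mul_le_mul_of_nonneg_left hz (norm_nonneg _)
      _ = c * ((‖shiftI p τ ν‖ * (‖shiftI p τ ν‖ + 1)⁻¹) *
            ((∏ j ∈ Finset.univ.erase ν, (‖shiftI p τ j‖ + 1)⁻¹) * (‖csq (shiftI p τ)‖ + 1)⁻¹)) := by
          rw [hsplit]; ring
      _ ≤ c * (1 * ((1 + 4 * κ ^ 2) * psi ν p)) := by
          refine mul_le_mul_of_nonneg_left ?_ hc
          exact mul_le_mul hνfac htail (mul_nonneg hrest0 hcsq0) zero_le_one
      _ = c * (1 + 4 * κ ^ 2) * psi ν p := by ring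

/-! ### Integrability of the majorants over `ℝ⁴` -/

/-- `(1 + t²)^{-a}` is integrable on `ℝ` for `a > 1/2`. [folklore] -/
private theorem integrable_one_add_sq_rpow_neg {a : ℝ} (ha : 1 / 2 < a) :
    Integrable fun t : ℝ => (1 + t ^ 2) ^ (-a) := by
  have h := integrable_rpow_neg_one_add_norm_sq (E := ℝ) (μ := volume) (r := 2 * a)
    (by rw [Module.finrank_self]; push_cast; linarith)
  refine h.congr (Eventually.of_forall fun t => ?_)
  simp only [Real.norm_eq_abs, sq_abs]
  congr 1; ring

/-- `(1 + |t|)⁻¹ ≤ (1 + t²)^{-1/2}`. [folklore] -/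
private theorem inv_one_add_abs_le_rpow (t : ℝ) : (1 + |t|)⁻¹ ≤ (1 + t ^ 2) ^ (-(1 / 2 : ℝ)) := by
  have h0 : 0 < 1 + t ^ 2 := by positivity
  rw [Real.rpow_neg h0.le, ← Real.sqrt_eq_rpow]
  refine inv_anti₀ (Real.sqrt_pos.2 h0) ?_
  rw [Real.sqrt_le_iff]
  constructor
  · positivity
  · nlinarith [abs_nonneg t, sq_abs t]

/-- `(1 + |t|)⁻¹ (1 + t²)^{-b}` is integrable on `ℝ` for `b > 0`. [folklore] -/
private theorem integrable_inv_one_add_abs_mul_rpow {b : ℝ} (hb : 0 < b) :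
    Integrable fun t : ℝ => (1 + |t|)⁻¹ * (1 + t ^ 2) ^ (-b) := by
  have hI := integrable_one_add_sq_rpow_neg (a := 1 / 2 + b) (by linarith)
  refine hI.mono' ?_ (Eventually.of_forall fun t => ?_)
  · exact Measurable.aestronglyMeasurable (by fun_prop)
  · have h0 : 0 < 1 + t ^ 2 := by positivity
    rw [Real.norm_of_nonneg (by positivity)]
    calc (1 + |t|)⁻¹ * (1 + t ^ 2) ^ (-b) ≤ (1 + t ^ 2) ^ (-(1 / 2 : ℝ)) * (1 + t ^ 2) ^ (-b) :=
          mul_le_mul_of_nonneg_right (inv_one_add_abs_le_rpow t) (by positivity)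
      _ = (1 + t ^ 2) ^ (-(1 / 2 + b)) := by rw [← Real.rpow_add h0]; congr 1; ring

/-- Exponent bookkeeping: `(1 + Σ_j p_j²)^{-(a + 3b)} ≤ (1 + p_ν²)^{-a} Π_{j ≠ ν} (1 + p_j²)^{-b}` for `a, b ≥ 0`. [folklore] -/
private theorem rpow_sum_le_prod (ν : Fin 4) {a b : ℝ} (ha : 0 ≤ a) (hb : 0 ≤ b) (p : Fin 4 → ℝ) :
    (1 + ∑ j, p j ^ 2) ^ (-(a + 3 * b)) ≤ (1 + p ν ^ 2) ^ (-a) * ∏ j ∈ Finset.univ.erase ν, (1 + p j ^ 2) ^ (-b) := by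
  set S := 1 + ∑ j, p j ^ 2 with hS
  have hsum0 : 0 ≤ ∑ j, p j ^ 2 := Finset.sum_nonneg fun j _ => sq_nonneg _
  have hS1 : 1 ≤ S := by rw [hS]; linarith
  have hS0 : 0 < S := by linarith
  have hle : ∀ j, 1 + p j ^ 2 ≤ S := fun j => by
    rw [hS]; have := Finset.single_le_sum (f := fun k => p k ^ 2) (fun k _ => sq_nonneg (p k)) (Finset.mem_univ j)
    simpa using this
  have hpos : ∀ j, 0 < 1 + p j ^ 2 := fun j => by positivity
  -- (1+p_ν²)^a Π (1+p_j²)^b ≤ S^(a+3b)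
  have hcard : (Finset.univ.erase ν).card = 3 := by rw [Finset.card_erase_of_mem (Finset.mem_univ ν)]; simp
  have hprod : (1 + p ν ^ 2) ^ a * ∏ j ∈ Finset.univ.erase ν, (1 + p j ^ 2) ^ b ≤ S ^ (a + 3 * b) := by
    have h1 : (1 + p ν ^ 2) ^ a ≤ S ^ a := Real.rpow_le_rpow (hpos ν).le (hle ν) ha
    have h2 : ∏ j ∈ Finset.univ.erase ν, (1 + p j ^ 2) ^ b ≤ ∏ _j ∈ Finset.univ.erase ν, S ^ b :=
      Finset.prod_le_prod (fun j _ => by positivity) fun j _ => Real.rpow_le_rpow (hpos j).le (hle j) hb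
    rw [Finset.prod_const, hcard] at h2
    calc _ ≤ S ^ a * (S ^ b) ^ 3 := mul_le_mul h1 h2 (Finset.prod_nonneg fun j _ => by positivity) (by positivity)
      _ = S ^ (a + 3 * b) := by
          rw [← Real.rpow_natCast (S ^ b) 3, ← Real.rpow_mul hS0.le, ← Real.rpow_add hS0]
          congr 1; push_cast; ring
  -- invert
  have hL : S ^ (-(a + 3 * b)) = (S ^ (a + 3 * b))⁻¹ := Real.rpow_neg hS0.le _
  have hR : (1 + p ν ^ 2) ^ (-a) * ∏ j ∈ Finset.univ.erase ν, (1 + p j ^ 2) ^ (-b) =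
      ((1 + p ν ^ 2) ^ a * ∏ j ∈ Finset.univ.erase ν, (1 + p j ^ 2) ^ b)⁻¹ := by
    rw [mul_inv, Real.rpow_neg (hpos ν).le, ← Finset.prod_inv_distrib]
    congr 1
    exact Finset.prod_congr rfl fun j _ => Real.rpow_neg (hpos j).le _
  rw [hL, hR]
  exact inv_anti₀ (by positivity) hprod

/-- **The weighted majorant is integrable over `ℝ⁴`:** `(1 + Σ_j p_j²)^{θ/2} ψ_ν(p)` is integrable for `θ < 1` (θ = 0 serves
(3.13)–(3.14), `θ = 1 − ε` serves (3.15)).  [cite: FederbushWilliamson1987PhaseCellII, (3.5) p. 1417, §IV p. 1417] -/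
theorem integrable_rpow_mul_psi (ν : Fin 4) {θ : ℝ} (hθ1 : θ < 1) :
    Integrable fun p : Fin 4 → ℝ => (1 + ∑ j, p j ^ 2) ^ (θ / 2) * psi ν p := by
  -- exponents
  set δ := 1 - θ with hδ
  have hδ0 : 0 < δ := by rw [hδ]; linarith
  set a := 1 / 2 + δ / 8 with ha
  set b := δ / 8 with hb
  have ha' : 1 / 2 < a := by rw [ha]; linarith
  have hb' : 0 < b := by rw [hb]; linarith
  -- the product of one-dimensional integrable factors
  set f : Fin 4 → ℝ → ℝ := fun j t => if j = ν then (1 + t ^ 2) ^ (-a) else (1 + |t|)⁻¹ * (1 + t ^ 2) ^ (-b) with hf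
  have hfi : ∀ j, Integrable (f j) := fun j => by
    by_cases hj : j = ν
    · simp only [hf, hj, if_true]; exact integrable_one_add_sq_rpow_neg ha'
    · simp only [hf, hj, if_false]; exact integrable_inv_one_add_abs_mul_rpow hb'
  have hprod : Integrable (fun p : Fin 4 → ℝ => ∏ j, f j (p j)) := by
    have := Integrable.fintype_prod (μ := fun _ : Fin 4 => (volume : Measure ℝ)) hfi
    rwa [← volume_pi] at this
  refine hprod.mono' ?_ (Eventually.of_forall fun p => ?_)
  · exact Measurable.aestronglyMeasurable (by unfold psi; fun_prop)
  · have hsum0 : 0 ≤ ∑ j, p j ^ 2 := Finset.sum_nonneg fun j _ => sq_nonneg _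
    have hS0 : 0 < 1 + ∑ j, p j ^ 2 := by positivity
    rw [Real.norm_of_nonneg (mul_nonneg (by positivity) (psi_nonneg ν p))]
    -- S^{θ/2} ψ = Π_{j≠ν}(1+|p_j|)⁻¹ · S^{-(1 - θ/2)} and 1 - θ/2 = a + 3b
    have hexp : (1 + ∑ j, p j ^ 2) ^ (θ / 2) * (1 + ∑ j, p j ^ 2)⁻¹ = (1 + ∑ j, p j ^ 2) ^ (-(a + 3 * b)) := by
      rw [← Real.rpow_neg_one, ← Real.rpow_add hS0]
      congr 1; rw [ha, hb, hδ]; ring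
    have hkey := rpow_sum_le_prod ν (by linarith : 0 ≤ a) hb'.le p
    have hsplit : ∏ j, f j (p j) = (1 + p ν ^ 2) ^ (-a) *
        ∏ j ∈ Finset.univ.erase ν, ((1 + |p j|)⁻¹ * (1 + p j ^ 2) ^ (-b)) := by
      rw [← Finset.mul_prod_erase Finset.univ (fun j => f j (p j)) (Finset.mem_univ ν)]
      simp only [hf, if_true]
      congr 1
      exact Finset.prod_congr rfl fun j hj => by rw [if_neg (Finset.ne_of_mem_erase hj)]
    rw [hsplit, Finset.prod_mul_distrib]
    unfold psi
    calc (1 + ∑ j, p j ^ 2) ^ (θ / 2) * ((∏ j ∈ Finset.univ.erase ν, (1 + |p j|)⁻¹) * (1 + ∑ j, p j ^ 2)⁻¹)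
        = (∏ j ∈ Finset.univ.erase ν, (1 + |p j|)⁻¹) * (1 + ∑ j, p j ^ 2) ^ (-(a + 3 * b)) := by
          rw [← hexp]; ring
      _ ≤ (∏ j ∈ Finset.univ.erase ν, (1 + |p j|)⁻¹) *
            ((1 + p ν ^ 2) ^ (-a) * ∏ j ∈ Finset.univ.erase ν, (1 + p j ^ 2) ^ (-b)) :=
          mul_le_mul_of_nonneg_left hkey (Finset.prod_nonneg fun j _ => by positivity)
      _ = _ := by ring

/-- In particular `ψ_ν` is integrable over `ℝ⁴`. [cite: FederbushWilliamson1987PhaseCellII, (3.5) p. 1417] -/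
theorem integrable_psi (ν : Fin 4) : Integrable (psi ν) := by
  have h := integrable_rpow_mul_psi ν zero_lt_one
  refine h.congr (Eventually.of_forall fun p => ?_)
  have : 0 ≤ ∑ j, p j ^ 2 := Finset.sum_nonneg fun j _ => sq_nonneg _
  simp [Real.rpow_zero]

/-- `ψ_ν(p) ≤ (1 + p_i²)⁻¹` in any single coordinate `i` (the one-dimensional slices of the majorant are integrable and vanish
at infinity, uniformly in the other coordinates). [cite: FederbushWilliamson1987PhaseCellII, (3.5) p. 1417] -/
theorem psi_le_inv_coord (ν i : Fin 4) (p : Fin 4 → ℝ) : psi ν p ≤ (1 + p i ^ 2)⁻¹ := by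
  unfold psi
  have h0 : 0 ≤ ∑ j, p j ^ 2 := Finset.sum_nonneg fun j _ => sq_nonneg _
  have h1 : (∏ j ∈ Finset.univ.erase ν, (1 + |p j|)⁻¹) ≤ 1 := by
    refine Finset.prod_le_one (fun j _ => by positivity) fun j _ => ?_
    exact inv_le_one_of_one_le₀ (by linarith [abs_nonneg (p j)])
  have hle : p i ^ 2 ≤ ∑ j, p j ^ 2 := by
    have := Finset.single_le_sum (f := fun k => p k ^ 2) (fun k _ => sq_nonneg (p k)) (Finset.mem_univ i)
    simpa using this
  have h2 : (1 + ∑ j, p j ^ 2)⁻¹ ≤ (1 + p i ^ 2)⁻¹ := inv_anti₀ (by positivity) (by linarith)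
  calc _ ≤ 1 * (1 + p i ^ 2)⁻¹ := mul_le_mul h1 h2 (by positivity) zero_le_one
    _ = _ := one_mul _

/-! ## §2 Iterated integration over `ℝ⁴` with one coordinate singled out, and the one-dimensional contour shift -/

/-- **Fubini, one coordinate singled out:** `∫_{ℝ⁴} F = ∫_{q ∈ ℝ³} ∫_{s ∈ ℝ} F(q with s inserted at i)` for integrable `F`
(Mathlib's `volume_preserving_piFinSuccAbove`, the template of `torusIntegral_succAbove`). [folklore] -/
private theorem integral_eq_iterated (i : Fin 4) (F : (Fin 4 → ℝ) → ℂ) (hF : Integrable F) :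
    ∫ p, F p = ∫ q : Fin 3 → ℝ, ∫ s : ℝ, F (i.insertNth s q) := by
  set e : ℝ × (Fin 3 → ℝ) ≃ᵐ (Fin 4 → ℝ) := (MeasurableEquiv.piFinSuccAbove (fun _ => ℝ) i).symm with he_def
  have hem : MeasurePreserving e := (volume_preserving_piFinSuccAbove (fun _ : Fin 4 => ℝ) i).symm _
  have he : ∀ s q, e (s, q) = i.insertNth s q := by
    intro s q
    simp [he_def, MeasurableEquiv.piFinSuccAbove_symm_apply, Fin.insertNthEquiv]
  have hint : Integrable (fun z : ℝ × (Fin 3 → ℝ) => F (e z)) ((volume : Measure ℝ).prod volume) := by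
    have h := (hem.integrable_comp_emb e.measurableEmbedding).2 hF
    rwa [Measure.volume_eq_prod] at h
  rw [← hem.integral_comp' , Measure.volume_eq_prod, integral_prod_symm _ hint]
  simp only [he]

/-- The slice of a tube point: inserting the complex coordinate `w` at `i` into the shifted remaining coordinates `q + iτ′`.
[cite: FederbushWilliamson1987PhaseCellII, §III p. 1417] -/
def sliceC (i : Fin 4) (q : Fin 3 → ℝ) (τ : Fin 4 → ℝ) (w : ℂ) : Momentum :=
  i.insertNth w (fun k => (q k : ℂ) + (τ (i.succAbove k) : ℂ) * I)

/-- The slice map is the shifted momentum: `sliceC i q τ (s + iy) = (insertNth i s q) + i(update τ i y)`.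
[cite: FederbushWilliamson1987PhaseCellII, §III p. 1417] -/
theorem sliceC_eq_shiftI (i : Fin 4) (q : Fin 3 → ℝ) (τ : Fin 4 → ℝ) (s y : ℝ) :
    sliceC i q τ ((s : ℂ) + (y : ℂ) * I) = shiftI (i.insertNth s q) (Function.update τ i y) := by
  funext j
  refine Fin.succAboveCases i ?_ (fun k => ?_) j
  · simp [sliceC, shiftI, Fin.insertNth_apply_same]
  · simp [sliceC, shiftI, Fin.insertNth_apply_succAbove]

/-- The slice map is complex-differentiable (affine in `w`). [folklore] -/
private theorem differentiable_sliceC (i : Fin 4) (q : Fin 3 → ℝ) (τ : Fin 4 → ℝ) : Differentiable ℂ (sliceC i q τ) := by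
  refine differentiable_pi.2 fun j => ?_
  refine Fin.succAboveCases i ?_ (fun k => ?_) j
  · simp only [sliceC, Fin.insertNth_apply_same]; exact differentiable_id
  · simp only [sliceC, Fin.insertNth_apply_succAbove]; exact differentiable_const _

/-- The slice through a point of the closed `κ`-tube stays in the open `ρ`-tube when `|Im w| < ρ`, `κ < ρ`.
[cite: FederbushWilliamson1987PhaseCellII, (3.3)–(3.4) p. 1417] -/
theorem sliceC_mem_DG (i : Fin 4) (q : Fin 3 → ℝ) {τ : Fin 4 → ℝ} {κ ρ : ℝ} (hτ : ∀ j, |τ j| ≤ κ) (hκ : κ < ρ)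
    {w : ℂ} (hw : |w.im| < ρ) : sliceC i q τ w ∈ DG ρ := by
  intro j
  refine Fin.succAboveCases i ?_ (fun k => ?_) j
  · simpa [sliceC, Fin.insertNth_apply_same] using hw
  · simp only [sliceC, Fin.insertNth_apply_succAbove]
    have : ((q k : ℂ) + (τ (i.succAbove k) : ℂ) * I).im = τ (i.succAbove k) := by simp
    rw [this]; exact lt_of_le_of_lt (hτ _) hκ

/-- Updating one coordinate inside the `κ`-box stays in the box. [folklore] -/
private theorem abs_update_le {τ : Fin 4 → ℝ} {κ : ℝ} (hτ : ∀ j, |τ j| ≤ κ) (i : Fin 4) {t : ℝ} (ht : |t| ≤ κ) (j : Fin 4) :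
    |Function.update τ i t j| ≤ κ := by
  rcases eq_or_ne j i with rfl | hj
  · simpa using ht
  · rw [Function.update_of_ne hj]; exact hτ j

/-- A majorant `‖H(p + iτ)‖ ≤ Bψ_ν(p)` forces `B ≥ 0`. [folklore] -/
private theorem nonneg_of_majorant {H : Momentum → ℂ} {B : ℝ} {ν : Fin 4} {τ : Fin 4 → ℝ}
    (h : ∀ p, ‖H (shiftI p τ)‖ ≤ B * psi ν p) : 0 ≤ B := by
  have h0 := h 0
  have hψ : psi ν 0 = 1 := by simp [psi]
  rw [hψ, mul_one] at h0
  exact (norm_nonneg _).trans h0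

/-- Continuity of `p ↦ H(p + iτ)` for `H` differentiable on the open tube containing the `κ`-tube. [folklore] -/
private theorem continuous_shift {H : Momentum → ℂ} {ρ κ : ℝ} (hκ : κ < ρ) (hH : DifferentiableOn ℂ H (DG ρ))
    {τ : Fin 4 → ℝ} (hτ : ∀ j, |τ j| ≤ κ) : Continuous fun p : Fin 4 → ℝ => H (shiftI p τ) := by
  have hc : Continuous fun p : Fin 4 → ℝ => shiftI p τ := by
    refine continuous_pi fun j => ?_
    simp only [shiftI]
    fun_prop
  refine hH.continuousOn.comp_continuous hc fun p => shiftI_mem_DG (fun j => lt_of_le_of_lt (hτ j) hκ) p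

/-- Integrability of `p ↦ H(p + iτ)` over `ℝ⁴` from the majorant. [cite: FederbushWilliamson1987PhaseCellII, (3.5) p. 1417] -/
theorem integrable_shift {H : Momentum → ℂ} {ρ κ B : ℝ} (hκ : κ < ρ) (ν : Fin 4) (hH : DifferentiableOn ℂ H (DG ρ))
    {τ : Fin 4 → ℝ} (hτ : ∀ j, |τ j| ≤ κ) (hmaj : ∀ p, ‖H (shiftI p τ)‖ ≤ B * psi ν p) :
    Integrable fun p : Fin 4 → ℝ => H (shiftI p τ) :=
  Integrable.mono' ((integrable_psi ν).const_mul B) (continuous_shift hκ hH hτ).aestronglyMeasurable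
    (Eventually.of_forall hmaj)

/-- **One-coordinate contour shift on `ℝ⁴`** («shifting the domain of integration … into a complex domain», GK 1980 App.;
the «standard techniques» of §IV): for `H` holomorphic on the open `ρ`-tube with the majorant `‖H(p + iτ)‖ ≤ Bψ_ν(p)` on the
closed `κ`-tube (`κ < ρ`), the integral `∫_{ℝ⁴} H(p + iτ) d⁴p` does not change when ONE component of `τ` is moved inside
`[−κ, κ]` — Fubini + the pole-free horizontal shift of the tree (`Literature.Analysis.Complex.integral_horizontal_eq_of_differentiableOn`)
in that coordinate, the vertical cross-sections vanishing by `ψ_ν ≤ (1 + p_i²)⁻¹`. [cite: FederbushWilliamson1987PhaseCellII, §III–§IV p. 1417] -/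
theorem shift_one_coord {H : Momentum → ℂ} {ρ κ B : ℝ} (hκ : κ < ρ) (ν : Fin 4)
    (hH : DifferentiableOn ℂ H (DG ρ))
    (hmaj : ∀ p τ, (∀ j, |τ j| ≤ κ) → ‖H (shiftI p τ)‖ ≤ B * psi ν p)
    {τ : Fin 4 → ℝ} (hτ : ∀ j, |τ j| ≤ κ) (i : Fin 4) {t : ℝ} (ht : |t| ≤ κ) :
    ∫ p, H (shiftI p τ) = ∫ p, H (shiftI p (Function.update τ i t)) := by
  have hτ' : ∀ j, |Function.update τ i t j| ≤ κ := abs_update_le hτ i ht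
  have hB : 0 ≤ B := nonneg_of_majorant (hmaj · τ hτ)
  rw [integral_eq_iterated i _ (integrable_shift hκ ν hH hτ fun p => hmaj p τ hτ),
    integral_eq_iterated i _ (integrable_shift hκ ν hH hτ' fun p => hmaj p _ hτ')]
  refine integral_congr_ae (Eventually.of_forall fun q => ?_)
  -- the one-dimensional problem in the coordinate i, through the real point q
  set F : ℂ → ℂ := fun w => H (sliceC i q τ w) with hFdef
  have hsame : ∀ s y : ℝ, H (shiftI (i.insertNth s q) (Function.update τ i y)) = F ((s : ℂ) + (y : ℂ) * I) := by
    intro s y; rw [hFdef]; simp only; rw [sliceC_eq_shiftI]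
  have hτi : Function.update τ i (τ i) = τ := Function.update_eq_self i τ
  have hL : (fun s : ℝ => H (shiftI (i.insertNth s q) τ)) = fun s : ℝ => F ((s : ℂ) + ((τ i : ℝ) : ℂ) * I) := by
    funext s; rw [← hsame s (τ i), hτi]
  have hR : (fun s : ℝ => H (shiftI (i.insertNth s q) (Function.update τ i t))) = fun s : ℝ => F ((s : ℂ) + (t : ℂ) * I) := by
    funext s; rw [← hsame s t]
  show (∫ s : ℝ, H (shiftI (i.insertNth s q) τ)) = ∫ s : ℝ, H (shiftI (i.insertNth s q) (Function.update τ i t))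
  rw [hL, hR]
  -- hypotheses of the pole-free horizontal shift
  set U : Set ℂ := {w | |w.im| < ρ} with hU
  have hUo : IsOpen U := isOpen_lt (continuous_abs.comp Complex.continuous_im) continuous_const
  have hFU : DifferentiableOn ℂ F U := by
    rw [hFdef]
    exact hH.comp (differentiable_sliceC i q τ).differentiableOn fun w hw => sliceC_mem_DG i q hτ hκ hw
  -- the majorant along horizontal lines |y| ≤ κ
  have hline : ∀ y : ℝ, |y| ≤ κ → ∀ s : ℝ, ‖F ((s : ℂ) + (y : ℂ) * I)‖ ≤ B * (1 + s ^ 2)⁻¹ := by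
    intro y hy s
    rw [← hsame s y]
    have hτy : ∀ j, |Function.update τ i y j| ≤ κ := abs_update_le hτ i hy
    calc _ ≤ B * psi ν (i.insertNth s q) := hmaj _ _ hτy
      _ ≤ B * (1 + s ^ 2)⁻¹ := by
          refine mul_le_mul_of_nonneg_left ?_ hB
          have := psi_le_inv_coord ν i (i.insertNth s q)
          rwa [Fin.insertNth_apply_same] at this
  have hcont : ∀ y : ℝ, |y| < ρ → Continuous fun s : ℝ => F ((s : ℂ) + (y : ℂ) * I) := by
    intro y hy
    refine hFU.continuousOn.comp_continuous (by fun_prop) fun s => ?_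
    show |((s : ℂ) + (y : ℂ) * I).im| < ρ
    simpa using hy
  have hint : ∀ y : ℝ, |y| ≤ κ → Integrable fun s : ℝ => F ((s : ℂ) + (y : ℂ) * I) := by
    intro y hy
    refine Integrable.mono' ((integrable_one_add_sq_rpow_neg (a := 1) (by norm_num)).const_mul B)
      (hcont y (lt_of_le_of_lt hy hκ)).aestronglyMeasurable (Eventually.of_forall fun s => ?_)
    rw [Real.rpow_neg_one]
    exact hline y hy s
  -- vanishing on the vertical cross-sections
  have hdecay : ∀ (a b : ℝ), |a| ≤ κ → |b| ≤ κ → ∀ ε : ℝ, 0 < ε → ∃ T₀ : ℝ, ∀ T : ℝ, T₀ ≤ |T| →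
      ∀ y ∈ Icc a b, ‖F ((T : ℂ) + (y : ℂ) * I)‖ ≤ ε := by
    intro a b ha hb ε hε
    refine ⟨B / ε + 1, fun T hT y hy => ?_⟩
    have hyκ : |y| ≤ κ := abs_le.2 ⟨by linarith [(abs_le.1 ha).1, hy.1], by linarith [(abs_le.1 hb).2, hy.2]⟩
    have hT1 : 1 ≤ |T| := le_trans (by have := div_nonneg hB hε.le; linarith) hT
    have hT0 : 0 < |T| := lt_of_lt_of_le one_pos hT1
    calc ‖F ((T : ℂ) + (y : ℂ) * I)‖ ≤ B * (1 + T ^ 2)⁻¹ := hline y hyκ T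
      _ ≤ B * |T|⁻¹ := by
          refine mul_le_mul_of_nonneg_left (inv_anti₀ hT0 ?_) hB
          nlinarith [sq_abs T]
      _ ≤ B * (B / ε + 1)⁻¹ := mul_le_mul_of_nonneg_left (inv_anti₀ (by positivity) hT) hB
      _ ≤ ε := by
          rw [← div_eq_mul_inv, div_le_iff₀ (by positivity)]
          have : ε * (B / ε + 1) = B + ε := by field_simp
          linarith
  -- shift from height τ i to height t (in either order)
  rcases le_total (τ i) t with hle | hle
  · exact _root_.Literature.Analysis.Complex.integral_horizontal_eq_of_differentiableOn hle U hUo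
      (fun w hw => lt_of_le_of_lt (abs_le.2 ⟨by linarith [(abs_le.1 (hτ i)).1, hw.1],
        by linarith [(abs_le.1 ht).2, hw.2]⟩) hκ)
      hFU (hint _ (hτ i)) (hint _ ht) (hdecay _ _ (hτ i) ht)
  · exact (_root_.Literature.Analysis.Complex.integral_horizontal_eq_of_differentiableOn hle U hUo
      (fun w hw => lt_of_le_of_lt (abs_le.2 ⟨by linarith [(abs_le.1 ht).1, hw.1],
        by linarith [(abs_le.1 (hτ i)).2, hw.2]⟩) hκ)
      hFU (hint _ ht) (hint _ (hτ i)) (hdecay _ _ ht (hτ i))).symm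

/-- **The full contour shift on `ℝ⁴`:** under the hypotheses of `shift_one_coord`, `∫_{ℝ⁴} H(p) d⁴p = ∫_{ℝ⁴} H(p + iσ) d⁴p`
for every `σ` in the closed `κ`-box (four one-coordinate shifts). [cite: FederbushWilliamson1987PhaseCellII, §III–§IV p. 1417] -/
theorem shift_all {H : Momentum → ℂ} {ρ κ B : ℝ} (hκ : κ < ρ) (hκ0 : 0 ≤ κ) (ν : Fin 4)
    (hH : DifferentiableOn ℂ H (DG ρ))
    (hmaj : ∀ p τ, (∀ j, |τ j| ≤ κ) → ‖H (shiftI p τ)‖ ≤ B * psi ν p)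
    {σ : Fin 4 → ℝ} (hσ : ∀ j, |σ j| ≤ κ) :
    ∫ p, H (toC p) = ∫ p, H (shiftI p σ) := by
  have h0 : ∀ j, |(0 : Fin 4 → ℝ) j| ≤ κ := fun j => by simpa using hκ0
  -- the chain 0 → τ₁ → τ₂ → τ₃ → σ
  set τ₁ := Function.update (0 : Fin 4 → ℝ) 0 (σ 0) with hτ₁
  set τ₂ := Function.update τ₁ 1 (σ 1) with hτ₂
  set τ₃ := Function.update τ₂ 2 (σ 2) with hτ₃
  have h1 : ∀ j, |τ₁ j| ≤ κ := abs_update_le h0 0 (hσ 0)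
  have h2 : ∀ j, |τ₂ j| ≤ κ := abs_update_le h1 1 (hσ 1)
  have h3 : ∀ j, |τ₃ j| ≤ κ := abs_update_le h2 2 (hσ 2)
  have hσeq : Function.update τ₃ 3 (σ 3) = σ := by
    funext j
    fin_cases j <;> simp [hτ₃, hτ₂, hτ₁, Function.update]
  calc ∫ p, H (toC p) = ∫ p, H (shiftI p 0) := by simp only [shiftI_zero]
    _ = ∫ p, H (shiftI p τ₁) := shift_one_coord hκ ν hH hmaj h0 0 (hσ 0)
    _ = ∫ p, H (shiftI p τ₂) := shift_one_coord hκ ν hH hmaj h1 1 (hσ 1)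
    _ = ∫ p, H (shiftI p τ₃) := shift_one_coord hκ ν hH hmaj h2 2 (hσ 2)
    _ = ∫ p, H (shiftI p σ) := by rw [← hσeq]; exact shift_one_coord hκ ν hH hmaj h3 3 (hσ 3)

/-! ## §3 (3.13): the shift applied to `e^{ip·x} Â(p)` -/

/-- `|e^{iz·x}| = e^{−Σ_j Im(z_j) x_j}`. [cite: Federbush1986PhaseCellI, (3.12)–(3.13) p. 328] -/
theorem norm_phase (x : E4) (z : Momentum) : ‖phase x z‖ = Real.exp (-∑ j, (z j).im * x j) := by
  unfold phase
  rw [Complex.norm_exp]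
  congr 1
  simp [Complex.mul_re, Complex.mul_im, Complex.im_sum]

/-- On the shifted contour: `|e^{i(p+iτ)·x}| = e^{−Σ_j τ_j x_j}`. [cite: Federbush1986PhaseCellI, (3.13) p. 328] -/
theorem norm_phase_shiftI (x : E4) (p τ : Fin 4 → ℝ) : ‖phase x (shiftI p τ)‖ = Real.exp (-∑ j, τ j * x j) := by
  rw [norm_phase]; simp

/-- On the `κ`-tube the character is bounded by `e^{κ Σ_j |x_j|}`. [cite: Federbush1986PhaseCellI, (3.13) p. 328] -/
theorem norm_phase_shiftI_le (x : E4) (p : Fin 4 → ℝ) {τ : Fin 4 → ℝ} {κ : ℝ} (hτ : ∀ j, |τ j| ≤ κ) :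
    ‖phase x (shiftI p τ)‖ ≤ Real.exp (κ * ∑ j, |x j|) := by
  rw [norm_phase_shiftI, Real.exp_le_exp, Finset.mul_sum, ← Finset.sum_neg_distrib]
  refine Finset.sum_le_sum fun j _ => ?_
  have h1 : -(τ j * x j) ≤ |τ j| * |x j| := by rw [← abs_mul]; exact neg_le_abs (τ j * x j)
  exact h1.trans (mul_le_mul_of_nonneg_right (hτ j) (abs_nonneg _))

/-- The sign pattern of the shift: `σ_j = κ` if `x_j ≥ 0`, `−κ` otherwise («in the direction of the vector x»).
[cite: FederbushWilliamson1987PhaseCellII, §IV p. 1417] -/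
def sgnShift (κ : ℝ) (x : E4) : Fin 4 → ℝ := fun j => if 0 ≤ x j then κ else -κ

/-- `|σ_j| ≤ κ`. [folklore] -/
private theorem abs_sgnShift_le {κ : ℝ} (hκ : 0 ≤ κ) (x : E4) (j : Fin 4) : |sgnShift κ x j| ≤ κ := by
  unfold sgnShift; split_ifs <;> simp [abs_of_nonneg hκ]

/-- `Σ_j σ_j x_j = κ Σ_j |x_j|`. [folklore] -/
private theorem sum_sgnShift_mul (κ : ℝ) (x : E4) : ∑ j, sgnShift κ x j * x j = κ * ∑ j, |x j| := by
  rw [Finset.mul_sum]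
  refine Finset.sum_congr rfl fun j _ => ?_
  unfold sgnShift
  split_ifs with h
  · rw [abs_of_nonneg h]
  · rw [abs_of_neg (not_le.1 h)]; ring

/-- On the optimally shifted contour the character decays: `|e^{i(p+iσ)·x}| = e^{−κ Σ_j |x_j|}`.
[cite: Federbush1986PhaseCellI, (3.13) p. 328] -/
theorem norm_phase_sgnShift (κ : ℝ) (x : E4) (p : Fin 4 → ℝ) :
    ‖phase x (shiftI p (sgnShift κ x))‖ = Real.exp (-(κ * ∑ j, |x j|)) := by
  rw [norm_phase_shiftI, sum_sgnShift_mul]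

/-- The Euclidean norm is at most the `ℓ¹` norm: `|x| ≤ Σ_j |x_j|`. [folklore] -/
private theorem norm_le_sum_abs (x : E4) : ‖x‖ ≤ ∑ j, |x j| := by
  rw [EuclideanSpace.norm_eq]
  refine Real.sqrt_le_iff.2 ⟨Finset.sum_nonneg fun j _ => abs_nonneg _, ?_⟩
  simp only [Real.norm_eq_abs]
  rw [sq, Finset.sum_mul_sum]
  refine Finset.sum_le_sum fun i _ => ?_
  rw [sq]
  exact Finset.single_le_sum (f := fun j => |x i| * |x j|) (fun j _ => by positivity) (Finset.mem_univ i)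

/-- `e^{−κΣ|x_j|} ≤ e^{−κ|x|}`. [folklore] -/
private theorem exp_neg_sum_le (x : E4) {κ : ℝ} (hκ : 0 ≤ κ) : Real.exp (-(κ * ∑ j, |x j|)) ≤ Real.exp (-κ * ‖x‖) := by
  rw [Real.exp_le_exp, neg_mul]
  exact neg_le_neg (mul_le_mul_of_nonneg_left (norm_le_sum_abs x) hκ)

/-- The character is entire in the momenta. [folklore] -/
private theorem differentiable_phase (x : E4) : Differentiable ℂ (phase x) := by
  unfold phase
  fun_prop

/-- The constant of (3.5) is non-negative (evaluate at `p = 0 ∈ 𝒟_B`). [cite: FederbushWilliamson1987PhaseCellII, (3.5) p. 1417] -/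
theorem const_nonneg_of_bound {Ahat : Momentum → ℂ} {ε₀ c : ℝ} (hε₀ : 0 < ε₀)
    (hB : ∀ z ∈ DB ε₀, ‖Ahat z‖ ≤ c * (∏ j, (‖z j‖ + 1)⁻¹) * (‖csq z‖ + 1)⁻¹) : 0 ≤ c := by
  have h := hB 0 (fun j => by simpa using half_pos hε₀)
  have hcsq : csq (0 : Momentum) = 0 := by simp [csq]
  simp [hcsq] at h
  exact (norm_nonneg _).trans h

/-- **The integrand of (3.13) on the tube.**  `H₀(z) = e^{iz·x}Â(z)` is holomorphic on `𝒟_{ε₀/2}` and obeys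
`‖H₀(p + iτ)‖ ≤ e^{κΣ|x_j|}·c(1 + 4κ²)·ψ_ν(p)` for `|τ_j| ≤ κ = ε₀/4`. [cite: FederbushWilliamson1987PhaseCellII, Thms 3.2–3.3, §IV p. 1417] -/
theorem H0_package {Ahat : Momentum → ℂ} {ε₀ c : ℝ} (hε₀ : 0 < ε₀) (hA : AnalyticOnNhd ℂ Ahat (DG ε₀))
    (hB : ∀ z ∈ DB ε₀, ‖Ahat z‖ ≤ c * (∏ j, (‖z j‖ + 1)⁻¹) * (‖csq z‖ + 1)⁻¹) (ν : Fin 4) (x : E4) :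
    DifferentiableOn ℂ (fun z => phase x z * Ahat z) (DG (ε₀ / 2)) ∧
      ∀ p τ, (∀ j, |τ j| ≤ ε₀ / 4) →
        ‖phase x (shiftI p τ) * Ahat (shiftI p τ)‖ ≤
          Real.exp (ε₀ / 4 * ∑ j, |x j|) * (c * (1 + 4 * (ε₀ / 4) ^ 2)) * psi ν p := by
  have hc := const_nonneg_of_bound hε₀ hB
  refine ⟨?_, fun p τ hτ => ?_⟩
  · refine (differentiable_phase x).differentiableOn.mul (hA.differentiableOn.mono fun z hz j => ?_)
    exact lt_trans (hz j) (by linarith)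
  · have hτ' : ∀ j, |τ j| < ε₀ / 2 := fun j => lt_of_le_of_lt (hτ j) (by linarith)
    have h1 := (norm_le_psi_of_bound hB hτ' hτ hc ν p).1
    have h2 := norm_phase_shiftI_le x p hτ
    rw [norm_mul]
    calc _ ≤ Real.exp (ε₀ / 4 * ∑ j, |x j|) * (c * (1 + 4 * (ε₀ / 4) ^ 2) * psi ν p) :=
          mul_le_mul h2 h1 (norm_nonneg _) (Real.exp_pos _).le
      _ = _ := by ring

/-- **(3.13) for the Fourier transform of an analytic, (3.5)-bounded mode** («|A^N_μ(x)| < ce^{−γ|x|}»): for every `Â` analytic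
on `𝒟_G = {|Im p_j| < ε₀}` with `|Â(p)| ≤ cΠ_j(|p_j| + 1)⁻¹(|p²| + 1)⁻¹` on `𝒟_B`, `|A(x)| ≤ C e^{−(ε₀/4)|x|}` with
`C = c(1 + ε₀²/4) ∫ψ_ν`.  Proof: shift the contour to `p + iσ`, `σ_j = ±ε₀/4` by the sign of `x_j` (`shift_all`), where
`|e^{i(p+iσ)·x}| = e^{−(ε₀/4)Σ|x_j|} ≤ e^{−(ε₀/4)|x|}`. [cite: Federbush1986PhaseCellI, (3.13) p. 328; FederbushWilliamson1987PhaseCellII, §IV p. 1417] -/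
theorem norm_modeFT_le {Ahat : Momentum → ℂ} {ε₀ c : ℝ} (hε₀ : 0 < ε₀) (hA : AnalyticOnNhd ℂ Ahat (DG ε₀))
    (hB : ∀ z ∈ DB ε₀, ‖Ahat z‖ ≤ c * (∏ j, (‖z j‖ + 1)⁻¹) * (‖csq z‖ + 1)⁻¹) (ν : Fin 4) (x : E4) :
    ‖modeFT Ahat x‖ ≤ c * (1 + 4 * (ε₀ / 4) ^ 2) * (∫ p, psi ν p) * Real.exp (-(ε₀ / 4) * ‖x‖) := by
  have hc := const_nonneg_of_bound hε₀ hB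
  set κ := ε₀ / 4 with hκdef
  have hκ0 : 0 ≤ κ := by rw [hκdef]; linarith
  have hκρ : κ < ε₀ / 2 := by rw [hκdef]; linarith
  obtain ⟨hH, hmaj⟩ := H0_package hε₀ hA hB ν x
  have hσ := abs_sgnShift_le hκ0 x
  -- shift the contour
  have hshift := shift_all hκρ hκ0 ν hH hmaj hσ
  unfold modeFT
  rw [show (fun p : Fin 4 → ℝ => phase x (toC p) * Ahat (toC p)) = fun p => (fun z => phase x z * Ahat z) (toC p) from rfl]
    at *
  rw [hshift]
  -- pointwise bound on the shifted contour with the EXACT character size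
  have hpt : ∀ p, ‖phase x (shiftI p (sgnShift κ x)) * Ahat (shiftI p (sgnShift κ x))‖ ≤
      Real.exp (-(κ * ∑ j, |x j|)) * (c * (1 + 4 * κ ^ 2)) * psi ν p := by
    intro p
    have hτ' : ∀ j, |sgnShift κ x j| < ε₀ / 2 := fun j => lt_of_le_of_lt (hσ j) hκρ
    have h1 := (norm_le_psi_of_bound hB hτ' hσ hc ν p).1
    rw [norm_mul, norm_phase_sgnShift]
    calc _ ≤ Real.exp (-(κ * ∑ j, |x j|)) * (c * (1 + 4 * κ ^ 2) * psi ν p) :=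
          mul_le_mul_of_nonneg_left h1 (Real.exp_pos _).le
      _ = _ := by ring
  have hint : Integrable fun p => Real.exp (-(κ * ∑ j, |x j|)) * (c * (1 + 4 * κ ^ 2)) * psi ν p :=
    (integrable_psi ν).const_mul _
  calc ‖∫ p, phase x (shiftI p (sgnShift κ x)) * Ahat (shiftI p (sgnShift κ x))‖
      ≤ ∫ p, ‖phase x (shiftI p (sgnShift κ x)) * Ahat (shiftI p (sgnShift κ x))‖ := norm_integral_le_integral_norm _
    _ ≤ ∫ p, Real.exp (-(κ * ∑ j, |x j|)) * (c * (1 + 4 * κ ^ 2)) * psi ν p :=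
        integral_mono_of_nonneg (Eventually.of_forall fun p => norm_nonneg _) hint (Eventually.of_forall hpt)
    _ = Real.exp (-(κ * ∑ j, |x j|)) * (c * (1 + 4 * κ ^ 2)) * ∫ p, psi ν p := integral_const_mul _ _
    _ ≤ Real.exp (-κ * ‖x‖) * (c * (1 + 4 * κ ^ 2)) * ∫ p, psi ν p := by
        have hI : 0 ≤ ∫ p, psi ν p := integral_nonneg (psi_nonneg ν)
        exact mul_le_mul_of_nonneg_right (mul_le_mul_of_nonneg_right (exp_neg_sum_le x hκ0) (by positivity)) hI
    _ = _ := by ring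

/-! ## §4 Differentiability of `A(x)` under the integral, `C¹`, and (3.14) -/

/-- The directional pairing `v ↦ i Σ_j p_j v_j` as a real-linear map `ℝ⁴ → ℂ` (the `x`-derivative of the exponent of
`e^{ip·x}`). [cite: Federbush1986PhaseCellI, (3.14) p. 328] -/
def dirCLM (p : Fin 4 → ℝ) : E4 →L[ℝ] ℂ :=
  ∑ j, ((p j : ℂ) * I) • (Complex.ofRealCLM.comp (EuclideanSpace.proj j))

/-- `dirCLM p v = i Σ_j p_j v_j`. [folklore] -/
private theorem dirCLM_apply (p : Fin 4 → ℝ) (v : E4) : dirCLM p v = I * ∑ j, (p j : ℂ) * ((v j : ℝ) : ℂ) := by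
  simp only [dirCLM, _root_.sum_apply, _root_.smul_apply, ContinuousLinearMap.comp_apply,
    Complex.ofRealCLM_apply, smul_eq_mul, Finset.mul_sum]
  refine Finset.sum_congr rfl fun j _ => ?_
  rw [show (EuclideanSpace.proj j : E4 →L[ℝ] ℝ) v = v j from rfl]
  ring

/-- The exponent of the character is the pairing: `e^{ip·x} = exp(dirCLM p x)`. [folklore] -/
private theorem phase_toC_eq (x : E4) (p : Fin 4 → ℝ) : phase x (toC p) = Complex.exp (dirCLM p x) := by
  rw [phase, dirCLM_apply]; rfl

/-- `‖dirCLM p‖ ≤ Σ_j |p_j|`. [folklore] -/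
private theorem norm_dirCLM_le (p : Fin 4 → ℝ) : ‖dirCLM p‖ ≤ ∑ j, |p j| := by
  refine ContinuousLinearMap.opNorm_le_bound _ (Finset.sum_nonneg fun j _ => abs_nonneg _) fun v => ?_
  rw [dirCLM_apply, norm_mul, Complex.norm_I, one_mul, Finset.sum_mul]
  refine (norm_sum_le _ _).trans (Finset.sum_le_sum fun j _ => ?_)
  rw [norm_mul, Complex.norm_real, Complex.norm_real, Real.norm_eq_abs, Real.norm_eq_abs]
  exact mul_le_mul_of_nonneg_left (by have h := PiLp.norm_apply_le v j; rwa [Real.norm_eq_abs] at h) (abs_nonneg _)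

/-- `dirCLM p (e_ν) = i p_ν`. [folklore] -/
private theorem dirCLM_unitVec (p : Fin 4 → ℝ) (ν : Fin 4) : dirCLM p (unitVec ν) = I * (p ν : ℂ) := by
  rw [dirCLM_apply]
  congr 1
  have : ∀ j, ((unitVec ν : E4) j : ℝ) = if j = ν then 1 else 0 := fun j => by
    simp [unitVec, EuclideanSpace.single, PiLp.single_apply]
  simp_rw [this]
  simp [Finset.sum_ite_eq', apply_ite Complex.ofReal]

/-- `p ↦ dirCLM p` is continuous. [folklore] -/
private theorem continuous_dirCLM : Continuous dirCLM := by
  unfold dirCLM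
  refine continuous_finsetSum _ fun j _ => ?_
  exact ((Complex.continuous_ofReal.comp (continuous_apply j)).mul continuous_const).smul continuous_const

/-- The `x`-derivative of the integrand: `D_x[e^{ip·x}Â(p)] = Â(p)·e^{ip·x}·dirCLM p`. [cite: Federbush1986PhaseCellI, (3.14) p. 328] -/
def dIntegrand (Ahat : Momentum → ℂ) (x : E4) (p : Fin 4 → ℝ) : E4 →L[ℝ] ℂ :=
  (Ahat (toC p) * phase x (toC p)) • dirCLM p

/-- The integrand is differentiable in `x` with derivative `dIntegrand`. [folklore] -/
private theorem hasFDerivAt_integrand (Ahat : Momentum → ℂ) (p : Fin 4 → ℝ) (x : E4) :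
    HasFDerivAt (fun y : E4 => phase y (toC p) * Ahat (toC p)) (dIntegrand Ahat x p) x := by
  have h1 : HasFDerivAt (fun y : E4 => Complex.exp (dirCLM p y)) (Complex.exp (dirCLM p x) • dirCLM p) x :=
    (dirCLM p).hasFDerivAt.cexp
  have h2 := h1.mul_const (Ahat (toC p))
  simp only [← phase_toC_eq] at h2
  unfold dIntegrand
  rw [← smul_smul]
  exact h2

/-- Norm of the `x`-derivative of the integrand: `≤ (Σ_j |p_j|)·|Â(p)|`, independent of `x` (`|e^{ip·x}| = 1` for real `p`).
[cite: Federbush1986PhaseCellI, (3.14) p. 328] -/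
theorem norm_dIntegrand_le (Ahat : Momentum → ℂ) (x : E4) (p : Fin 4 → ℝ) :
    ‖dIntegrand Ahat x p‖ ≤ (∑ j, |p j|) * ‖Ahat (toC p)‖ := by
  unfold dIntegrand
  rw [norm_smul, norm_mul]
  have hph : ‖phase x (toC p)‖ = 1 := by rw [← shiftI_zero, norm_phase_shiftI]; simp
  rw [hph, mul_one, mul_comm]
  exact mul_le_mul_of_nonneg_right (norm_dirCLM_le p) (norm_nonneg _)

/-- The dominating function for the `x`-derivative: `(Σ_j|p_j|)|Â(p)| ≤ c Σ_j ψ_j(p)` under (3.5). [cite: FederbushWilliamson1987PhaseCellII, (3.5) p. 1417] -/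
theorem sum_abs_mul_norm_le {Ahat : Momentum → ℂ} {ε₀ c : ℝ} (hε₀ : 0 < ε₀)
    (hB : ∀ z ∈ DB ε₀, ‖Ahat z‖ ≤ c * (∏ j, (‖z j‖ + 1)⁻¹) * (‖csq z‖ + 1)⁻¹) (p : Fin 4 → ℝ) :
    (∑ j, |p j|) * ‖Ahat (toC p)‖ ≤ c * ∑ j, psi j p := by
  have hc := const_nonneg_of_bound hε₀ hB
  have h0 : ∀ j, |(0 : Fin 4 → ℝ) j| < ε₀ / 2 := fun j => by simpa using half_pos hε₀
  have h0' : ∀ j, |(0 : Fin 4 → ℝ) j| ≤ 0 := fun j => by simp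
  rw [Finset.sum_mul, Finset.mul_sum]
  refine Finset.sum_le_sum fun j _ => ?_
  have h := (norm_le_psi_of_bound hB h0 h0' hc j p).2
  rw [shiftI_zero, norm_mul] at h
  have hn : ‖toC p j‖ = |p j| := by simp [toC]
  rw [hn] at h
  simpa using h

/-- **`A(x)` is differentiable, with derivative obtained under the integral sign** (dominated differentiation, dominating
function `cΣ_jψ_j`). [cite: Federbush1986PhaseCellI, (3.14) p. 328; FederbushWilliamson1987PhaseCellII, §IV p. 1417] -/
theorem hasFDerivAt_modeFT {Ahat : Momentum → ℂ} {ε₀ c : ℝ} (hε₀ : 0 < ε₀) (hA : AnalyticOnNhd ℂ Ahat (DG ε₀))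
    (hB : ∀ z ∈ DB ε₀, ‖Ahat z‖ ≤ c * (∏ j, (‖z j‖ + 1)⁻¹) * (‖csq z‖ + 1)⁻¹) (x : E4) :
    Integrable (dIntegrand Ahat x) ∧ HasFDerivAt (modeFT Ahat) (∫ p, dIntegrand Ahat x p) x := by
  have hc := const_nonneg_of_bound hε₀ hB
  have hκρ : (ε₀ / 4) < ε₀ / 2 := by linarith
  have h0 : ∀ j, |(0 : Fin 4 → ℝ) j| ≤ ε₀ / 4 := fun j => by simp; linarith
  -- continuity of p ↦ Â(p) on the reals and of the integrands
  have hAd : DifferentiableOn ℂ Ahat (DG (ε₀ / 2)) := hA.differentiableOn.mono fun z hz j => lt_trans (hz j) (by linarith)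
  have hAc : Continuous fun p : Fin 4 → ℝ => Ahat (toC p) := by
    have := continuous_shift hκρ hAd h0; simpa only [shiftI_zero] using this
  have hphc : ∀ y : E4, Continuous fun p : Fin 4 → ℝ => phase y (toC p) := fun y => by
    have := continuous_shift hκρ (differentiable_phase y).differentiableOn h0; simpa only [shiftI_zero] using this
  have hFc : ∀ y : E4, Continuous fun p : Fin 4 → ℝ => phase y (toC p) * Ahat (toC p) := fun y => (hphc y).mul hAc
  have hF'c : ∀ y : E4, Continuous fun p : Fin 4 → ℝ => dIntegrand Ahat y p := fun y => by
    unfold dIntegrand; exact (hAc.mul (hphc y)).smul continuous_dirCLM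
  -- integrability of the integrand at x
  have hint : Integrable fun p : Fin 4 → ℝ => phase x (toC p) * Ahat (toC p) := by
    obtain ⟨hH, hmaj⟩ := H0_package hε₀ hA hB 0 x
    have := integrable_shift hκρ 0 hH h0 fun p => hmaj p 0 h0
    simpa only [shiftI_zero] using this
  -- the bound
  have hbound : ∀ y p, ‖dIntegrand Ahat y p‖ ≤ c * ∑ j, psi j p := fun y p =>
    (norm_dIntegrand_le Ahat y p).trans (sum_abs_mul_norm_le hε₀ hB p)
  have hbint : Integrable fun p : Fin 4 → ℝ => c * ∑ j, psi j p :=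
    (integrable_finsetSum _ fun j _ => integrable_psi j).const_mul c
  refine ⟨Integrable.mono' hbint (hF'c x).aestronglyMeasurable (Eventually.of_forall (hbound x)), ?_⟩
  exact hasFDerivAt_integral_of_dominated_of_fderiv_le (F' := fun y p => dIntegrand Ahat y p) (bound := fun p => c * ∑ j, psi j p)
    univ_mem (Eventually.of_forall fun y => (hFc y).aestronglyMeasurable) hint (hF'c x).aestronglyMeasurable
    (Eventually.of_forall fun p y _ => hbound y p) hbint (Eventually.of_forall fun p y _ => hasFDerivAt_integrand Ahat p y)

/-- **`A(x)` is `C¹`** (continuity of the derivative by dominated convergence). [cite: Federbush1986PhaseCellI, (3.13)–(3.15) p. 328] -/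
theorem contDiff_modeFT {Ahat : Momentum → ℂ} {ε₀ c : ℝ} (hε₀ : 0 < ε₀) (hA : AnalyticOnNhd ℂ Ahat (DG ε₀))
    (hB : ∀ z ∈ DB ε₀, ‖Ahat z‖ ≤ c * (∏ j, (‖z j‖ + 1)⁻¹) * (‖csq z‖ + 1)⁻¹) : ContDiff ℝ 1 (modeFT Ahat) := by
  have hd := fun x => (hasFDerivAt_modeFT hε₀ hA hB x).2
  rw [contDiff_one_iff_fderiv]
  refine ⟨fun x => (hd x).differentiableAt, ?_⟩
  have hfd : fderiv ℝ (modeFT Ahat) = fun x => ∫ p, dIntegrand Ahat x p := funext fun x => (hd x).fderiv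
  rw [hfd]
  have hκρ : (ε₀ / 4) < ε₀ / 2 := by linarith
  have h0 : ∀ j, |(0 : Fin 4 → ℝ) j| ≤ ε₀ / 4 := fun j => by simp; linarith
  have hAd : DifferentiableOn ℂ Ahat (DG (ε₀ / 2)) := hA.differentiableOn.mono fun z hz j => lt_trans (hz j) (by linarith)
  have hAc : Continuous fun p : Fin 4 → ℝ => Ahat (toC p) := by
    have := continuous_shift hκρ hAd h0; simpa only [shiftI_zero] using this
  have hphc : ∀ y : E4, Continuous fun p : Fin 4 → ℝ => phase y (toC p) := fun y => by
    have := continuous_shift hκρ (differentiable_phase y).differentiableOn h0; simpa only [shiftI_zero] using this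
  refine continuous_of_dominated (F := fun (y : E4) (p : Fin 4 → ℝ) => dIntegrand Ahat y p) (bound := fun p => c * ∑ j, psi j p)
    (fun y => ?_) (fun y => Eventually.of_forall fun p => (norm_dIntegrand_le Ahat y p).trans (sum_abs_mul_norm_le hε₀ hB p))
    ((integrable_finsetSum _ fun j _ => integrable_psi j).const_mul c) (Eventually.of_forall fun p => ?_)
  · unfold dIntegrand; exact ((hAc.mul (hphc y)).smul continuous_dirCLM).aestronglyMeasurable
  · have hc1 : Continuous fun y : E4 => phase y (toC p) := by
      simp_rw [phase_toC_eq]; exact Complex.continuous_exp.comp (dirCLM p).continuous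
    have hc2 : Continuous fun y : E4 => Ahat (toC p) * phase y (toC p) := continuous_const.mul hc1
    unfold dIntegrand
    exact hc2.smul continuous_const

/-- The integrand of the `ν`-th partial derivative: `H_ν(z) = Â(z)·e^{iz·x}·(i z_ν)`.
[cite: Federbush1986PhaseCellI, (3.14) p. 328] -/
def dKernel (Ahat : Momentum → ℂ) (ν : Fin 4) (x : E4) (z : Momentum) : ℂ := Ahat z * phase x z * (I * z ν)

/-- **The partial derivatives of `A(x)` as momentum integrals:** `∂_νA(x) = ∫ Â(p)e^{ip·x}(ip_ν) d⁴p`.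
[cite: Federbush1986PhaseCellI, (3.14) p. 328] -/
theorem fderiv_modeFT_unitVec {Ahat : Momentum → ℂ} {ε₀ c : ℝ} (hε₀ : 0 < ε₀) (hA : AnalyticOnNhd ℂ Ahat (DG ε₀))
    (hB : ∀ z ∈ DB ε₀, ‖Ahat z‖ ≤ c * (∏ j, (‖z j‖ + 1)⁻¹) * (‖csq z‖ + 1)⁻¹) (x : E4) (ν : Fin 4) :
    fderiv ℝ (modeFT Ahat) x (unitVec ν) = ∫ p, dKernel Ahat ν x (toC p) := by
  obtain ⟨hi, hd⟩ := hasFDerivAt_modeFT hε₀ hA hB x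
  rw [hd.fderiv, ContinuousLinearMap.integral_apply hi]
  refine integral_congr_ae (Eventually.of_forall fun p => ?_)
  show dIntegrand Ahat x p (unitVec ν) = dKernel Ahat ν x (toC p)
  simp only [dIntegrand, _root_.smul_apply, dirCLM_unitVec, smul_eq_mul, dKernel]
  rfl

/-- **The shifted-contour bound, abstract form.**  If `H` is holomorphic on `𝒟_{ε₀/2}` and `‖H(p + iτ)‖ ≤ |e^{i(p+iτ)·x}|·M·ψ_ν(p)`
on the `ε₀/4`-tube, then `|∫_{ℝ⁴} H(p) d⁴p| ≤ M (∫ψ_ν) e^{−(ε₀/4)|x|}` (shift to `σ_j = ±ε₀/4` by the sign of `x_j`).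
[cite: FederbushWilliamson1987PhaseCellII, §IV p. 1417] -/
theorem norm_integral_le_of_phase_majorant {H : Momentum → ℂ} {ε₀ M : ℝ} (hε₀ : 0 < ε₀) (hM : 0 ≤ M) (ν : Fin 4) (x : E4)
    (hH : DifferentiableOn ℂ H (DG (ε₀ / 2)))
    (hmaj : ∀ p τ, (∀ j, |τ j| ≤ ε₀ / 4) → ‖H (shiftI p τ)‖ ≤ ‖phase x (shiftI p τ)‖ * M * psi ν p) :
    ‖∫ p, H (toC p)‖ ≤ M * (∫ p, psi ν p) * Real.exp (-(ε₀ / 4) * ‖x‖) := by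
  set κ := ε₀ / 4 with hκdef
  have hκ0 : 0 ≤ κ := by rw [hκdef]; linarith
  have hκρ : κ < ε₀ / 2 := by rw [hκdef]; linarith
  -- the B-majorant on the tube
  have hmajB : ∀ p τ, (∀ j, |τ j| ≤ κ) → ‖H (shiftI p τ)‖ ≤ Real.exp (κ * ∑ j, |x j|) * M * psi ν p := by
    intro p τ hτ
    refine (hmaj p τ hτ).trans ?_
    exact mul_le_mul_of_nonneg_right (mul_le_mul_of_nonneg_right (norm_phase_shiftI_le x p hτ) hM) (psi_nonneg ν p)
  have hσ := abs_sgnShift_le hκ0 x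
  rw [shift_all hκρ hκ0 ν hH hmajB hσ]
  have hpt : ∀ p, ‖H (shiftI p (sgnShift κ x))‖ ≤ Real.exp (-(κ * ∑ j, |x j|)) * M * psi ν p := by
    intro p
    have h := hmaj p _ hσ
    rwa [norm_phase_sgnShift] at h
  have hint : Integrable fun p => Real.exp (-(κ * ∑ j, |x j|)) * M * psi ν p := (integrable_psi ν).const_mul _
  calc ‖∫ p, H (shiftI p (sgnShift κ x))‖ ≤ ∫ p, ‖H (shiftI p (sgnShift κ x))‖ := norm_integral_le_integral_norm _
    _ ≤ ∫ p, Real.exp (-(κ * ∑ j, |x j|)) * M * psi ν p :=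
        integral_mono_of_nonneg (Eventually.of_forall fun p => norm_nonneg _) hint (Eventually.of_forall hpt)
    _ = Real.exp (-(κ * ∑ j, |x j|)) * M * ∫ p, psi ν p := integral_const_mul _ _
    _ ≤ Real.exp (-κ * ‖x‖) * M * ∫ p, psi ν p := by
        have hI : 0 ≤ ∫ p, psi ν p := integral_nonneg (psi_nonneg ν)
        exact mul_le_mul_of_nonneg_right (mul_le_mul_of_nonneg_right (exp_neg_sum_le x hκ0) hM) hI
    _ = _ := by ring

/-- The derivative kernel on the tube: holomorphic on `𝒟_{ε₀/2}`, majorant `|e^{iz·x}|·c(1+ε₀²/4)·ψ_ν`.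
[cite: FederbushWilliamson1987PhaseCellII, Thms 3.2–3.3, §IV p. 1417] -/
theorem dKernel_package {Ahat : Momentum → ℂ} {ε₀ c : ℝ} (hε₀ : 0 < ε₀) (hA : AnalyticOnNhd ℂ Ahat (DG ε₀))
    (hB : ∀ z ∈ DB ε₀, ‖Ahat z‖ ≤ c * (∏ j, (‖z j‖ + 1)⁻¹) * (‖csq z‖ + 1)⁻¹) (ν : Fin 4) (x : E4) :
    DifferentiableOn ℂ (dKernel Ahat ν x) (DG (ε₀ / 2)) ∧
      ∀ p τ, (∀ j, |τ j| ≤ ε₀ / 4) →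
        ‖dKernel Ahat ν x (shiftI p τ)‖ ≤ ‖phase x (shiftI p τ)‖ * (c * (1 + 4 * (ε₀ / 4) ^ 2)) * psi ν p := by
  have hc := const_nonneg_of_bound hε₀ hB
  refine ⟨?_, fun p τ hτ => ?_⟩
  · have hAd : DifferentiableOn ℂ Ahat (DG (ε₀ / 2)) := hA.differentiableOn.mono fun z hz j => lt_trans (hz j) (by linarith)
    unfold dKernel
    refine (hAd.mul (differentiable_phase x).differentiableOn).mul ?_
    exact ((differentiable_apply ν).const_mul I).differentiableOn
  · have hτ' : ∀ j, |τ j| < ε₀ / 2 := fun j => lt_of_le_of_lt (hτ j) (by linarith)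
    have h2 := (norm_le_psi_of_bound hB hτ' hτ hc ν p).2
    rw [norm_mul] at h2
    unfold dKernel
    rw [norm_mul, norm_mul, norm_mul, Complex.norm_I, one_mul]
    calc ‖Ahat (shiftI p τ)‖ * ‖phase x (shiftI p τ)‖ * ‖shiftI p τ ν‖
        = ‖phase x (shiftI p τ)‖ * (‖shiftI p τ ν‖ * ‖Ahat (shiftI p τ)‖) := by ring
      _ ≤ ‖phase x (shiftI p τ)‖ * (c * (1 + 4 * (ε₀ / 4) ^ 2) * psi ν p) :=
          mul_le_mul_of_nonneg_left h2 (norm_nonneg _)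
      _ = _ := by ring

/-- **(3.14) for the Fourier transform of an analytic, (3.5)-bounded mode** («|DA^N_μ(x)| < ce^{−γ|x|}»):
`|∂_νA(x)| ≤ c(1 + ε₀²/4)(∫ψ_ν) e^{−(ε₀/4)|x|}`. [cite: Federbush1986PhaseCellI, (3.14) p. 328; FederbushWilliamson1987PhaseCellII, §IV p. 1417] -/
theorem norm_fderiv_modeFT_le {Ahat : Momentum → ℂ} {ε₀ c : ℝ} (hε₀ : 0 < ε₀) (hA : AnalyticOnNhd ℂ Ahat (DG ε₀))
    (hB : ∀ z ∈ DB ε₀, ‖Ahat z‖ ≤ c * (∏ j, (‖z j‖ + 1)⁻¹) * (‖csq z‖ + 1)⁻¹) (x : E4) (ν : Fin 4) :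
    ‖fderiv ℝ (modeFT Ahat) x (unitVec ν)‖ ≤
      c * (1 + 4 * (ε₀ / 4) ^ 2) * (∫ p, psi ν p) * Real.exp (-(ε₀ / 4) * ‖x‖) := by
  have hc := const_nonneg_of_bound hε₀ hB
  obtain ⟨hH, hmaj⟩ := dKernel_package hε₀ hA hB ν x
  rw [fderiv_modeFT_unitVec hε₀ hA hB x ν]
  exact norm_integral_le_of_phase_majorant hε₀ (by positivity) ν x hH hmaj

/-! ## §5 (3.15): the Hölder quotient of `DA` -/

/-- `|e^w − 1| ≤ 2e^{|Re w|}|w|^θ` for `0 ≤ θ ≤ 1` (linear for small `w`, bounded for large `w` on vertical strips). [folklore] -/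
private theorem norm_exp_sub_one_le_rpow (w : ℂ) {θ : ℝ} (hθ0 : 0 ≤ θ) (hθ1 : θ ≤ 1) :
    ‖Complex.exp w - 1‖ ≤ 2 * Real.exp |w.re| * ‖w‖ ^ θ := by
  have hE : 1 ≤ Real.exp |w.re| := Real.one_le_exp (abs_nonneg _)
  by_cases hw : ‖w‖ ≤ 1
  · rcases eq_or_lt_of_le (norm_nonneg w) with h0 | hpos
    · have : w = 0 := norm_eq_zero.1 h0.symm
      subst this; simp [Real.rpow_nonneg]
    · have h1 : ‖w‖ ≤ ‖w‖ ^ θ := by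
        have := Real.rpow_le_rpow_of_exponent_ge hpos hw hθ1
        rwa [Real.rpow_one] at this
      calc ‖Complex.exp w - 1‖ ≤ 2 * ‖w‖ := Complex.norm_exp_sub_one_le hw
        _ ≤ 2 * Real.exp |w.re| * ‖w‖ ^ θ := by nlinarith [norm_nonneg w, Real.rpow_nonneg (norm_nonneg w) θ]
  · rw [not_le] at hw
    have h1 : 1 ≤ ‖w‖ ^ θ := Real.one_le_rpow hw.le hθ0
    have h2 : ‖Complex.exp w - 1‖ ≤ Real.exp |w.re| + 1 :=
      (norm_sub_le _ _).trans (by rw [Complex.norm_exp, norm_one]; exact add_le_add (Real.exp_le_exp.2 (le_abs_self _)) le_rfl)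
    nlinarith [Real.exp_pos |w.re|]

/-- The two characters differ by a character of the displacement: `e^{iz·y} = e^{iz·x}·e^{iz·(y−x)}`. [folklore] -/
private theorem phase_eq_phase_mul (x y : E4) (z : Momentum) :
    phase y z = phase x z * Complex.exp (I * ∑ j, z j * (((y j - x j : ℝ)) : ℂ)) := by
  unfold phase
  rw [← Complex.exp_add]
  congr 1
  rw [← mul_add, ← Finset.sum_add_distrib]
  congr 1
  refine Finset.sum_congr rfl fun j _ => ?_
  push_cast; ring

/-- The coordinates of a difference in `ℝ⁴` are bounded by its norm. [folklore] -/
private theorem abs_sub_apply_le (x y : E4) (j : Fin 4) : |y j - x j| ≤ ‖x - y‖ := by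
  have h := PiLp.norm_apply_le (y - x) j
  rw [Real.norm_eq_abs, PiLp.sub_apply, norm_sub_rev] at h
  exact h

/-- The size of the displacement exponent on the tube: `|iz·(y−x)| ≤ (Σ_j|p_j| + 4κ)|x−y|` and `|Re(iz·(y−x))| ≤ 4κ|x−y|` for
`z = p + iτ`, `|τ_j| ≤ κ`. [folklore] -/
private theorem displacement_bounds (x y : E4) (p : Fin 4 → ℝ) {τ : Fin 4 → ℝ} {κ : ℝ} (hκ : 0 ≤ κ) (hτ : ∀ j, |τ j| ≤ κ) :
    ‖I * ∑ j, shiftI p τ j * (((y j - x j : ℝ)) : ℂ)‖ ≤ ((∑ j, |p j|) + 4 * κ) * ‖x - y‖ ∧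
      |(I * ∑ j, shiftI p τ j * (((y j - x j : ℝ)) : ℂ)).re| ≤ 4 * κ * ‖x - y‖ := by
  have hd := abs_sub_apply_le x y
  constructor
  · rw [norm_mul, Complex.norm_I, one_mul]
    refine (norm_sum_le _ _).trans ?_
    have hz : ∀ j, ‖shiftI p τ j‖ ≤ |p j| + κ := fun j => by
      unfold shiftI
      refine (norm_add_le _ _).trans (add_le_add ?_ ?_)
      · rw [Complex.norm_real, Real.norm_eq_abs]
      · rw [norm_mul, Complex.norm_I, mul_one, Complex.norm_real, Real.norm_eq_abs]; exact hτ j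
    calc ∑ j, ‖shiftI p τ j * (((y j - x j : ℝ)) : ℂ)‖ ≤ ∑ j, (|p j| + κ) * ‖x - y‖ := by
          refine Finset.sum_le_sum fun j _ => ?_
          rw [norm_mul, Complex.norm_real, Real.norm_eq_abs]
          exact mul_le_mul (hz j) (hd j) (abs_nonneg _) (by positivity)
      _ = ((∑ j, |p j|) + 4 * κ) * ‖x - y‖ := by rw [← Finset.sum_mul, Finset.sum_add_distrib]; simp
  · have hre : (I * ∑ j, shiftI p τ j * (((y j - x j : ℝ)) : ℂ)).re = -∑ j, τ j * (y j - x j) := by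
      simp [Complex.mul_re, Complex.mul_im, Complex.im_sum, shiftI]
    rw [hre, abs_neg]
    refine (Finset.abs_sum_le_sum_abs _ _).trans ?_
    calc ∑ j, |τ j * (y j - x j)| ≤ ∑ _j : Fin 4, κ * ‖x - y‖ := Finset.sum_le_sum fun j _ => by
          rw [abs_mul]; exact mul_le_mul (hτ j) (hd j) (abs_nonneg _) hκ
      _ = 4 * κ * ‖x - y‖ := by simp; ring

/-- `1 + Σ_j|p_j| ≤ 5(1 + Σ_j p_j²)^{1/2}`. [folklore] -/
private theorem one_add_sum_abs_le (p : Fin 4 → ℝ) : 1 + ∑ j, |p j| ≤ 5 * (1 + ∑ j, p j ^ 2) ^ (1 / 2 : ℝ) := by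
  have hS0 : 0 ≤ ∑ j, p j ^ 2 := Finset.sum_nonneg fun j _ => sq_nonneg _
  rw [← Real.sqrt_eq_rpow]
  have h1 : 1 ≤ Real.sqrt (1 + ∑ j, p j ^ 2) := by
    rw [Real.le_sqrt (by norm_num) (by positivity)]; linarith
  have h2 : ∀ j, |p j| ≤ Real.sqrt (1 + ∑ k, p k ^ 2) := fun j => by
    rw [← Real.sqrt_sq_eq_abs]
    refine Real.sqrt_le_sqrt ?_
    have := Finset.single_le_sum (f := fun k => p k ^ 2) (fun k _ => sq_nonneg (p k)) (Finset.mem_univ j)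
    linarith
  calc 1 + ∑ j, |p j| ≤ Real.sqrt (1 + ∑ k, p k ^ 2) + ∑ _j : Fin 4, Real.sqrt (1 + ∑ k, p k ^ 2) :=
        add_le_add h1 (Finset.sum_le_sum fun j _ => h2 j)
    _ = 5 * Real.sqrt (1 + ∑ j, p j ^ 2) := by simp; ring

/-- The momentum weight of (3.15): `(Σ_j|p_j| + 4κ)^θ ≤ 5(1 + 4κ)(1 + Σ_j p_j²)^{θ/2}` for `0 ≤ θ ≤ 1`. [folklore] -/
private theorem weight_rpow_le (p : Fin 4 → ℝ) {κ θ : ℝ} (hκ : 0 ≤ κ) (hθ0 : 0 ≤ θ) (hθ1 : θ ≤ 1) :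
    ((∑ j, |p j|) + 4 * κ) ^ θ ≤ 5 * (1 + 4 * κ) * (1 + ∑ j, p j ^ 2) ^ (θ / 2) := by
  have hS0 : 0 ≤ ∑ j, p j ^ 2 := Finset.sum_nonneg fun j _ => sq_nonneg _
  have hA0 : 0 ≤ ∑ j, |p j| := Finset.sum_nonneg fun j _ => abs_nonneg _
  set R := (1 + ∑ j, p j ^ 2) ^ (1 / 2 : ℝ) with hR
  have hR1 : 1 ≤ R := by rw [hR]; exact Real.one_le_rpow (by linarith) (by norm_num)
  have hbase : (∑ j, |p j|) + 4 * κ ≤ (5 * (1 + 4 * κ)) * R := by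
    have h := one_add_sum_abs_le p
    rw [← hR] at h
    nlinarith
  calc ((∑ j, |p j|) + 4 * κ) ^ θ ≤ ((5 * (1 + 4 * κ)) * R) ^ θ := Real.rpow_le_rpow (by positivity) hbase hθ0
    _ = (5 * (1 + 4 * κ)) ^ θ * R ^ θ := Real.mul_rpow (by positivity) (by positivity)
    _ ≤ (5 * (1 + 4 * κ)) * R ^ θ := by
        refine mul_le_mul_of_nonneg_right ?_ (Real.rpow_nonneg (by positivity) θ)
        have h5 : (1 : ℝ) ≤ 5 * (1 + 4 * κ) := by nlinarith
        calc (5 * (1 + 4 * κ)) ^ θ ≤ (5 * (1 + 4 * κ)) ^ (1 : ℝ) := Real.rpow_le_rpow_of_exponent_le h5 hθ1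
          _ = _ := Real.rpow_one _
    _ = 5 * (1 + 4 * κ) * (1 + ∑ j, p j ^ 2) ^ (θ / 2) := by
        rw [hR, ← Real.rpow_mul (by positivity)]; congr 1; ring

/-- From a character-weighted majorant to a plain one on the `ε₀/4`-tube (`|e^{i(p+iτ)·x}| ≤ e^{(ε₀/4)Σ|x_j|}`). [folklore] -/
private theorem majB_of_phase {H : Momentum → ℂ} {ε₀ M : ℝ} (hM : 0 ≤ M) (ν : Fin 4) (x : E4)
    (hmaj : ∀ p τ, (∀ j, |τ j| ≤ ε₀ / 4) → ‖H (shiftI p τ)‖ ≤ ‖phase x (shiftI p τ)‖ * M * psi ν p) :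
    ∀ p τ, (∀ j, |τ j| ≤ ε₀ / 4) → ‖H (shiftI p τ)‖ ≤ Real.exp (ε₀ / 4 * ∑ j, |x j|) * M * psi ν p :=
  fun p τ hτ => (hmaj p τ hτ).trans
    (mul_le_mul_of_nonneg_right (mul_le_mul_of_nonneg_right (norm_phase_shiftI_le x p hτ) hM) (psi_nonneg ν p))

/-- **(3.15) for the Fourier transform of an analytic, (3.5)-bounded mode** (Hölder continuity of `DA` with exponential
weight): for `|x − y| < 1` and `0 ≤ θ < 1`,
`|∂_νA(x) − ∂_νA(y)| ≤ 10e^{ε₀}(1 + ε₀)·c(1 + ε₀²/4)·(∫(1 + Σp_j²)^{θ/2}ψ_ν)·|x − y|^θ·e^{−(ε₀/4)|x|}` — both derivatives are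
written on the SAME shifted contour `p + iσ(x)`; the characters differ by `|e^{iz·(y−x)} − 1| ≤ 2e^{ε₀}((Σ|p_j| + ε₀)|x−y|)^θ`.
[cite: Federbush1986PhaseCellI, (3.15) p. 328; FederbushWilliamson1987PhaseCellII, §IV p. 1417] -/
theorem norm_fderiv_modeFT_sub_le {Ahat : Momentum → ℂ} {ε₀ c : ℝ} (hε₀ : 0 < ε₀) (hA : AnalyticOnNhd ℂ Ahat (DG ε₀))
    (hB : ∀ z ∈ DB ε₀, ‖Ahat z‖ ≤ c * (∏ j, (‖z j‖ + 1)⁻¹) * (‖csq z‖ + 1)⁻¹) (ν : Fin 4) {x y : E4}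
    (hxy : dist x y < 1) {θ : ℝ} (hθ0 : 0 ≤ θ) (hθ1 : θ < 1) :
    ‖fderiv ℝ (modeFT Ahat) x (unitVec ν) - fderiv ℝ (modeFT Ahat) y (unitVec ν)‖ ≤
      10 * Real.exp ε₀ * (1 + ε₀) * (c * (1 + 4 * (ε₀ / 4) ^ 2)) *
        (∫ p, (1 + ∑ j, p j ^ 2) ^ (θ / 2) * psi ν p) * dist x y ^ θ * Real.exp (-(ε₀ / 4) * ‖x‖) := by
  have hc := const_nonneg_of_bound hε₀ hB
  set κ := ε₀ / 4 with hκdef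
  have hκ0 : 0 ≤ κ := by rw [hκdef]; linarith
  have hκρ : κ < ε₀ / 2 := by rw [hκdef]; linarith
  have h4κ : 4 * κ = ε₀ := by rw [hκdef]; ring
  set M := c * (1 + 4 * κ ^ 2) with hMdef
  have hM : 0 ≤ M := by rw [hMdef]; positivity
  obtain ⟨hHx, hmajx⟩ := dKernel_package hε₀ hA hB ν x
  obtain ⟨hHy, hmajy⟩ := dKernel_package hε₀ hA hB ν y
  have hσ := abs_sgnShift_le hκ0 x
  have hBx := majB_of_phase hM ν x hmajx
  have hBy := majB_of_phase hM ν y hmajy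
  rw [fderiv_modeFT_unitVec hε₀ hA hB x ν, fderiv_modeFT_unitVec hε₀ hA hB y ν,
    shift_all hκρ hκ0 ν hHx hBx hσ, shift_all hκρ hκ0 ν hHy hBy hσ,
    ← integral_sub (integrable_shift hκρ ν hHx hσ fun p => hBx p _ hσ) (integrable_shift hκρ ν hHy hσ fun p => hBy p _ hσ)]
  have hd : dist x y = ‖x - y‖ := dist_eq_norm x y
  have hxy' : ‖x - y‖ < 1 := hd ▸ hxy
  -- pointwise bound on the common contour
  have hpt : ∀ p, ‖dKernel Ahat ν x (shiftI p (sgnShift κ x)) - dKernel Ahat ν y (shiftI p (sgnShift κ x))‖ ≤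
      Real.exp (-(κ * ∑ j, |x j|)) * (10 * Real.exp ε₀ * (1 + ε₀) * M) * dist x y ^ θ *
        ((1 + ∑ j, p j ^ 2) ^ (θ / 2) * psi ν p) := by
    intro p
    set z := shiftI p (sgnShift κ x) with hzdef
    set w : ℂ := I * ∑ j, z j * (((y j - x j : ℝ)) : ℂ) with hwdef
    have hw : phase y z = phase x z * Complex.exp w := phase_eq_phase_mul x y z
    have hdiff : dKernel Ahat ν x z - dKernel Ahat ν y z = Ahat z * phase x z * (I * z ν) * (1 - Complex.exp w) := by
      unfold dKernel; rw [hw]; ring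
    rw [hdiff, norm_mul]
    have h1 : ‖Ahat z * phase x z * (I * z ν)‖ ≤ Real.exp (-(κ * ∑ j, |x j|)) * M * psi ν p := by
      have h := hmajx p _ hσ
      rwa [norm_phase_sgnShift] at h
    have h2 : ‖1 - Complex.exp w‖ ≤ 2 * Real.exp |w.re| * ‖w‖ ^ θ := by
      rw [norm_sub_rev]; exact norm_exp_sub_one_le_rpow w hθ0 hθ1.le
    obtain ⟨hwn, hwre⟩ := displacement_bounds x y p hκ0 hσ
    have h3 : Real.exp |w.re| ≤ Real.exp ε₀ := by
      rw [Real.exp_le_exp]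
      calc |w.re| ≤ 4 * κ * ‖x - y‖ := hwre
        _ ≤ 4 * κ * 1 := mul_le_mul_of_nonneg_left hxy'.le (by positivity)
        _ = ε₀ := by rw [mul_one, h4κ]
    have h4 : ‖w‖ ^ θ ≤ 5 * (1 + 4 * κ) * (1 + ∑ j, p j ^ 2) ^ (θ / 2) * ‖x - y‖ ^ θ := by
      calc ‖w‖ ^ θ ≤ (((∑ j, |p j|) + 4 * κ) * ‖x - y‖) ^ θ := Real.rpow_le_rpow (norm_nonneg _) hwn hθ0
        _ = ((∑ j, |p j|) + 4 * κ) ^ θ * ‖x - y‖ ^ θ :=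
            Real.mul_rpow (by positivity) (norm_nonneg _)
        _ ≤ _ := mul_le_mul_of_nonneg_right (weight_rpow_le p hκ0 hθ0 hθ1.le) (Real.rpow_nonneg (norm_nonneg _) θ)
    have hS0 : 0 ≤ (1 + ∑ j, p j ^ 2) ^ (θ / 2) := Real.rpow_nonneg (by positivity) _
    have hdθ : 0 ≤ ‖x - y‖ ^ θ := Real.rpow_nonneg (norm_nonneg _) θ
    have h5 : ‖1 - Complex.exp w‖ ≤ 2 * Real.exp ε₀ * (5 * (1 + 4 * κ) * (1 + ∑ j, p j ^ 2) ^ (θ / 2) * ‖x - y‖ ^ θ) :=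
      h2.trans (mul_le_mul (mul_le_mul_of_nonneg_left h3 zero_le_two) h4 (Real.rpow_nonneg (norm_nonneg _) θ) (by positivity))
    rw [hd, h4κ] at *
    calc ‖Ahat z * phase x z * (I * z ν)‖ * ‖1 - Complex.exp w‖
        ≤ (Real.exp (-(κ * ∑ j, |x j|)) * M * psi ν p) *
            (2 * Real.exp ε₀ * (5 * (1 + ε₀) * (1 + ∑ j, p j ^ 2) ^ (θ / 2) * ‖x - y‖ ^ θ)) :=
          mul_le_mul h1 h5 (norm_nonneg _) (by have := psi_nonneg ν p; positivity)
      _ = _ := by ring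
  -- integrate
  have hint : Integrable fun p : Fin 4 → ℝ => Real.exp (-(κ * ∑ j, |x j|)) * (10 * Real.exp ε₀ * (1 + ε₀) * M) *
      dist x y ^ θ * ((1 + ∑ j, p j ^ 2) ^ (θ / 2) * psi ν p) := (integrable_rpow_mul_psi ν hθ1).const_mul _
  have hI0 : 0 ≤ ∫ p : Fin 4 → ℝ, (1 + ∑ j, p j ^ 2) ^ (θ / 2) * psi ν p :=
    integral_nonneg fun p => mul_nonneg (Real.rpow_nonneg (by positivity) _) (psi_nonneg ν p)
  have hdθ : 0 ≤ dist x y ^ θ := Real.rpow_nonneg dist_nonneg θ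
  calc ‖∫ p, (dKernel Ahat ν x (shiftI p (sgnShift κ x)) - dKernel Ahat ν y (shiftI p (sgnShift κ x)))‖
      ≤ ∫ p, ‖dKernel Ahat ν x (shiftI p (sgnShift κ x)) - dKernel Ahat ν y (shiftI p (sgnShift κ x))‖ :=
        norm_integral_le_integral_norm _
    _ ≤ ∫ p, Real.exp (-(κ * ∑ j, |x j|)) * (10 * Real.exp ε₀ * (1 + ε₀) * M) * dist x y ^ θ *
          ((1 + ∑ j, p j ^ 2) ^ (θ / 2) * psi ν p) :=
        integral_mono_of_nonneg (Eventually.of_forall fun p => norm_nonneg _) hint (Eventually.of_forall hpt)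
    _ = Real.exp (-(κ * ∑ j, |x j|)) * (10 * Real.exp ε₀ * (1 + ε₀) * M) * dist x y ^ θ *
          ∫ p, (1 + ∑ j, p j ^ 2) ^ (θ / 2) * psi ν p := integral_const_mul _ _
    _ ≤ Real.exp (-κ * ‖x‖) * (10 * Real.exp ε₀ * (1 + ε₀) * M) * dist x y ^ θ *
          ∫ p, (1 + ∑ j, p j ^ 2) ^ (θ / 2) * psi ν p := by
        refine mul_le_mul_of_nonneg_right (mul_le_mul_of_nonneg_right
          (mul_le_mul_of_nonneg_right (exp_neg_sum_le x hκ0) (by positivity)) hdθ) hI0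
    _ = _ := by ring

/-! ## §6 §IV assembled: the decay package I (3.13)–(3.15) for the real position-space field -/

/-- The (real) position-space field of a four-component momentum-space mode: `A_μ(x) = Re ∫ e^{ip·x} Â_μ(p) d⁴p` (for a mode
with `Â_μ(−p) = \overline{Â_μ(p)}` the integral is already real). [cite: Federbush1986PhaseCellI, (3.12)–(3.13) p. 328] -/
def modeField (Ahat : Fin 4 → Momentum → ℂ) (x : E4) (μ : Fin 4) : ℝ := (modeFT (Ahat μ) x).re

/-- The field is `C¹`. [cite: Federbush1986PhaseCellI, (3.13)–(3.15) p. 328] -/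
theorem contDiff_modeField {Ahat : Fin 4 → Momentum → ℂ} {ε₀ c : ℝ} (hε₀ : 0 < ε₀)
    (hA : ∀ μ, AnalyticOnNhd ℂ (Ahat μ) (DG ε₀))
    (hB : ∀ μ, ∀ z ∈ DB ε₀, ‖Ahat μ z‖ ≤ c * (∏ j, (‖z j‖ + 1)⁻¹) * (‖csq z‖ + 1)⁻¹) :
    ContDiff ℝ 1 (modeField Ahat) :=
  contDiff_pi.2 fun μ => Complex.reCLM.contDiff.comp (contDiff_modeFT hε₀ (hA μ) (hB μ))

/-- The partial derivatives of the field are the real parts of those of `∫ e^{ip·x} Â_μ`. [cite: Federbush1986PhaseCellI, (3.14) p. 328] -/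
theorem pd_modeField {Ahat : Fin 4 → Momentum → ℂ} {ε₀ c : ℝ} (hε₀ : 0 < ε₀)
    (hA : ∀ μ, AnalyticOnNhd ℂ (Ahat μ) (DG ε₀))
    (hB : ∀ μ, ∀ z ∈ DB ε₀, ‖Ahat μ z‖ ≤ c * (∏ j, (‖z j‖ + 1)⁻¹) * (‖csq z‖ + 1)⁻¹) (x : E4) (ν μ : Fin 4) :
    pd (modeField Ahat) ν μ x = (fderiv ℝ (modeFT (Ahat μ)) x (unitVec ν)).re := by
  unfold pd modeField
  have hd := (hasFDerivAt_modeFT hε₀ (hA μ) (hB μ) x).2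
  have h := Complex.reCLM.hasFDerivAt.comp x hd
  rw [show (fun y => (modeFT (Ahat μ) y).re) = (Complex.reCLM : ℂ → ℝ) ∘ modeFT (Ahat μ) from rfl, h.fderiv, hd.fderiv]
  rfl

/-- **§IV PROVED: «Equations (3.13)–(3.15) of Ref. 1 follow directly from Theorems 3.2 and 3.3 of the last section by standard
techniques.»**  For every four-component momentum-space mode `Â_μ` analytic on `𝒟_G = {|Im p_j| < ε₀}` (the conclusion of
Theorem 3.2, shape of `ModeAnalyticity.Theorem32`) and bounded by `cΠ_j(|p_j| + 1)⁻¹(|p²| + 1)⁻¹` on `𝒟_B = {|Im p_j| < ε₀/2}`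
(the conclusion of Theorem 3.3, shape of `ModeAnalyticity.Theorem33`), its position-space field satisfies I (3.13)–(3.15) —
it inhabits the typed decay package `AbelianAveraging.Decay313to315` of `Federbush1986/AbelianModeEstimates` (F1.Eq3.13-3.15),
with rate `γ = ε₀/4`.  (The typed antecedents `Theorem32`/`Theorem33` for the printed `A^N_1` in the printed gauge are refuted
as typed at `p = 0`, `ModeAnalyticityThm31Refutation`; this theorem is the printed IMPLICATION, for every mode of the asserted
shape.) [cite: FederbushWilliamson1987PhaseCellII, §IV p. 1417; Federbush1986PhaseCellI, (3.13)–(3.15) p. 328] -/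
theorem decay313to315_modeField {Ahat : Fin 4 → Momentum → ℂ} {ε₀ c : ℝ} (hε₀ : 0 < ε₀)
    (hA : ∀ μ, AnalyticOnNhd ℂ (Ahat μ) (DG ε₀))
    (hB : ∀ μ, ∀ z ∈ DB ε₀, ‖Ahat μ z‖ ≤ c * (∏ j, (‖z j‖ + 1)⁻¹) * (‖csq z‖ + 1)⁻¹) :
    AbelianAveraging.Decay313to315 (modeField Ahat) := by
  have hc := const_nonneg_of_bound hε₀ (hB 0)
  set κ := ε₀ / 4 with hκdef
  have hκ0 : 0 < κ := by rw [hκdef]; linarith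
  set M := c * (1 + 4 * (ε₀ / 4) ^ 2) with hMdef
  have hM : 0 ≤ M := by rw [hMdef]; positivity
  set Ipsi := ∑ ν : Fin 4, ∫ p, psi ν p with hIdef
  have hIν : ∀ ν, 0 ≤ ∫ p, psi ν p := fun ν => integral_nonneg (psi_nonneg ν)
  have hIle : ∀ ν, ∫ p, psi ν p ≤ Ipsi := fun ν =>
    Finset.single_le_sum (f := fun ν' => ∫ p, psi ν' p) (fun ν' _ => hIν ν') (Finset.mem_univ ν)
  have hI0 : 0 ≤ Ipsi := (hIν 0).trans (hIle 0)
  -- the Hölder constants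
  set θ : ℝ → ℝ := fun ε => 1 - min ε 1 with hθdef
  set K := 10 * Real.exp ε₀ * (1 + ε₀) * M with hKdef
  have hK : 0 ≤ K := by rw [hKdef]; positivity
  set J : ℝ → ℝ := fun ε => ∑ ν : Fin 4, ∫ p, (1 + ∑ j, p j ^ 2) ^ (θ ε / 2) * psi ν p with hJdef
  have hJν : ∀ ε ν, 0 ≤ ∫ p : Fin 4 → ℝ, (1 + ∑ j, p j ^ 2) ^ (θ ε / 2) * psi ν p := fun ε ν =>
    integral_nonneg fun p => mul_nonneg (Real.rpow_nonneg (by positivity) _) (psi_nonneg ν p)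
  have hJle : ∀ ε ν, ∫ p : Fin 4 → ℝ, (1 + ∑ j, p j ^ 2) ^ (θ ε / 2) * psi ν p ≤ J ε := fun ε ν =>
    Finset.single_le_sum (f := fun ν' => ∫ p : Fin 4 → ℝ, (1 + ∑ j, p j ^ 2) ^ (θ ε / 2) * psi ν' p)
      (fun ν' _ => hJν ε ν') (Finset.mem_univ ν)
  refine ⟨M * Ipsi + 1, by positivity, κ, hκ0, fun ε => K * J ε + 1, contDiff_modeField hε₀ hA hB, ?_, ?_, ?_⟩
  · -- (3.13)
    intro x μ
    have h := norm_modeFT_le hε₀ (hA μ) (hB μ) 0 x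
    have hE := Real.exp_pos (-κ * ‖x‖)
    calc |modeField Ahat x μ| ≤ ‖modeFT (Ahat μ) x‖ := Complex.abs_re_le_norm _
      _ ≤ M * (∫ p, psi 0 p) * Real.exp (-κ * ‖x‖) := h
      _ ≤ M * Ipsi * Real.exp (-κ * ‖x‖) := by gcongr; exact hIle 0
      _ < (M * Ipsi + 1) * Real.exp (-κ * ‖x‖) := by nlinarith
  · -- (3.14)
    intro x ν μ
    rw [pd_modeField hε₀ hA hB]
    have h := norm_fderiv_modeFT_le hε₀ (hA μ) (hB μ) x ν
    have hE := Real.exp_pos (-κ * ‖x‖)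
    calc |(fderiv ℝ (modeFT (Ahat μ)) x (unitVec ν)).re| ≤ ‖fderiv ℝ (modeFT (Ahat μ)) x (unitVec ν)‖ :=
          Complex.abs_re_le_norm _
      _ ≤ M * (∫ p, psi ν p) * Real.exp (-κ * ‖x‖) := h
      _ ≤ M * Ipsi * Real.exp (-κ * ‖x‖) := by gcongr; exact hIle ν
      _ < (M * Ipsi + 1) * Real.exp (-κ * ‖x‖) := by nlinarith
  · -- (3.15)
    intro ε hε x y ν μ hne hdist
    have hθ0 : 0 ≤ θ ε := by simp only [hθdef]; have := min_le_right ε 1; linarith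
    have hθ1 : θ ε < 1 := by simp only [hθdef]; have := lt_min hε one_pos; linarith
    have hθε : 1 - ε ≤ θ ε := by simp only [hθdef]; have := min_le_left ε 1; linarith
    have hd0 : 0 < dist x y := dist_pos.2 hne
    rw [pd_modeField hε₀ hA hB, pd_modeField hε₀ hA hB, ← Complex.sub_re]
    have h := norm_fderiv_modeFT_sub_le hε₀ (hA μ) (hB μ) ν hdist hθ0 hθ1
    have hE := Real.exp_pos (-κ * ‖x‖)
    have hden : 0 < dist x y ^ (1 - ε) := Real.rpow_pos_of_pos hd0 _
    have hpow : dist x y ^ θ ε ≤ dist x y ^ (1 - ε) := Real.rpow_le_rpow_of_exponent_ge hd0 hdist.le hθε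
    rw [div_lt_iff₀ hden]
    calc |(fderiv ℝ (modeFT (Ahat μ)) x (unitVec ν) - fderiv ℝ (modeFT (Ahat μ)) y (unitVec ν)).re|
        ≤ ‖fderiv ℝ (modeFT (Ahat μ)) x (unitVec ν) - fderiv ℝ (modeFT (Ahat μ)) y (unitVec ν)‖ :=
          Complex.abs_re_le_norm _
      _ ≤ K * (∫ p, (1 + ∑ j, p j ^ 2) ^ (θ ε / 2) * psi ν p) * dist x y ^ θ ε * Real.exp (-κ * ‖x‖) := by
          rw [hKdef]; exact h
      _ ≤ K * J ε * dist x y ^ (1 - ε) * Real.exp (-κ * ‖x‖) := by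
          have h1 : K * (∫ p, (1 + ∑ j, p j ^ 2) ^ (θ ε / 2) * psi ν p) ≤ K * J ε :=
            mul_le_mul_of_nonneg_left (hJle ε ν) hK
          have h2 : 0 ≤ K * J ε := mul_nonneg hK ((hJν ε ν).trans (hJle ε ν))
          exact mul_le_mul_of_nonneg_right (mul_le_mul h1 hpow (Real.rpow_nonneg dist_nonneg _) h2) hE.le
      _ < (K * J ε + 1) * Real.exp (-κ * ‖x‖) * dist x y ^ (1 - ε) := by nlinarith [mul_pos hE hden]

/-! ## §7 The implication from the typed Theorems 3.2–3.3 of `ModeAnalyticity` -/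

/-- **§IV from Theorem 3.3-shaped data, component by component** (each component with its own `ε₀`, extension `g_μ` and
constant `c_μ`, exactly as `ModeAnalyticity.Theorem33` delivers them): the position-space field of `(g_μ)` satisfies
I (3.13)–(3.15). [cite: FederbushWilliamson1987PhaseCellII, Theorem 3.3 (3.4)–(3.5), §IV p. 1417] -/
theorem decay313to315_of_theorem33_shape {g : Fin 4 → Momentum → ℂ} {εf cf : Fin 4 → ℝ} (hε : ∀ μ, 0 < εf μ)
    (hA : ∀ μ, AnalyticOnNhd ℂ (g μ) (DG (εf μ)))
    (hB : ∀ μ, ∀ p ∈ DB (εf μ), ‖g μ p‖ < cf μ * (∏ j, 1 / (‖p j‖ + 1)) * (1 / (‖csq p‖ + 1))) :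
    AbelianAveraging.Decay313to315 (modeField g) := by
  set ε₀ := Finset.univ.inf' Finset.univ_nonempty εf with hε₀def
  have hε₀ : 0 < ε₀ := by rw [hε₀def, Finset.lt_inf'_iff]; exact fun μ _ => hε μ
  have hle : ∀ μ, ε₀ ≤ εf μ := fun μ => Finset.inf'_le _ (Finset.mem_univ μ)
  set c := ∑ μ, |cf μ| with hcdef
  have hcμ : ∀ μ, cf μ ≤ c := fun μ =>
    (le_abs_self _).trans (Finset.single_le_sum (f := fun μ' => |cf μ'|) (fun μ' _ => abs_nonneg _) (Finset.mem_univ μ))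
  refine decay313to315_modeField (c := c) hε₀ (fun μ => (hA μ).mono fun z hz j => lt_of_lt_of_le (hz j) (hle μ)) fun μ z hz => ?_
  have hz' : z ∈ DB (εf μ) := fun j => lt_of_lt_of_le (hz j) (by linarith [hle μ])
  have h := hB μ z hz'
  have hP : 0 ≤ (∏ j, 1 / (‖z j‖ + 1)) * (1 / (‖csq z‖ + 1)) :=
    mul_nonneg (Finset.prod_nonneg fun j _ => by positivity) (by positivity)
  calc ‖g μ z‖ ≤ cf μ * (∏ j, 1 / (‖z j‖ + 1)) * (1 / (‖csq z‖ + 1)) := h.le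
    _ = cf μ * ((∏ j, 1 / (‖z j‖ + 1)) * (1 / (‖csq z‖ + 1))) := by ring
    _ ≤ c * ((∏ j, 1 / (‖z j‖ + 1)) * (1 / (‖csq z‖ + 1))) := mul_le_mul_of_nonneg_right (hcμ μ) hP
    _ = c * (∏ j, (‖z j‖ + 1)⁻¹) * (‖csq z‖ + 1)⁻¹ := by simp only [one_div]; ring

/-- **§IV as the typed implication** from the packaged typed statement `ModeAnalyticity.Theorems31to33` (Theorems 3.1–3.3 for
all large `s`, shared `ε₀`): for every large `s` the analytic extensions `g_i` of the four components `A^N_i` (agreeing with the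
formula (2.4) at the real generic momenta) have a position-space field obeying I (3.13)–(3.15).  HONEST SCOPE: the antecedent is
refuted as typed for the printed `A^N_1` in the printed gauge (`ModeAnalyticityThm31Refutation.not_theorems31to33`, pole at
`p = 0`); the mathematical content of §IV is `decay313to315_modeField`, which holds for every mode of the asserted shape.
[cite: FederbushWilliamson1987PhaseCellII, §IV p. 1417; Federbush1986PhaseCellI, (3.13)–(3.15) p. 328] -/
theorem decay313to315_of_theorems31to33 (h : Theorems31to33) :
    ∃ s₀ : ℕ, ∀ s, s₀ ≤ s → ∃ g : Fin 4 → Momentum → ℂ,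
      (∀ i, ∀ p ∈ realGeneric, g i p = AN s i p) ∧ AbelianAveraging.Decay313to315 (modeField g) := by
  obtain ⟨s₀, hs⟩ := h
  refine ⟨s₀, fun s hs' => ?_⟩
  choose εf hεf g hL hG hagree cf hcf using hs s hs'
  exact ⟨g, hagree, decay313to315_of_theorem33_shape hεf hG hcf⟩

end ModeDecay

end

end Literature.MathematicalPhysics.QuantumFieldTheory.Federbush1986
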